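import Literature.Analysis.FluidPDE.MollifiedNSRTripleBounds
import Literature.Analysis.FunctionSpaces.TorusInverseLaplacianCalculus
import HarnessLib

/-!
# Gluing two Navier–Stokes–Reynolds triples in time, and derivatives of the antidivergence

Analysis/FluidPDE support file (everything proved; no named facts). Two tools for the energy
iterate of Buckmaster–Vicol, *Nonuniqueness of weak solutions to the Navier–Stokes equation*,
Ann. of Math. 189 (2019), Prop. 2.1 / §6 (where the successor `v_{q+1}` must coincide with `v_q`
at the times where the prescribed energy profile is already met, and with the perturbed mollified
field elsewhere):

* **`ℛ` commutes with derivatives.** For the explicit De Lellis–Székelyhidi antidivergence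
  `Torus.antidivergence` (`FluidPDE/Antidivergence`, built from `Δ⁻¹` and `∂ᵢ`):
  `∂ₗ(ℛv) = ℛ(∂ₗv)` for smooth `v` and `∂ₜ(ℛ f(t)) = ℛ(∂ₜf(t))` for jointly smooth `f` on
  `[a, b] × 𝕋^d` (one-sided in time), from `Torus.partialDeriv_invLaplacian`,
  `Torus.timeDerivWithin_invLaplacian`, `Torus.timeDerivWithin_partialDeriv_comm`; hence sup
  bounds `‖∂ₗℛv‖ ≤ K sup‖∂ₗv‖`, `‖∂ₜℛf‖ ≤ K sup‖∂ₜf‖` with the constant of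
  `Torus.exists_norm_antidivergence_le`.
* **Time gluing of NSR triples** (the device of Isett / Buckmaster–De Lellis–Székelyhidi–Vicol,
  CPAM 72 (2019), §4.1–4.2, here for two triples and an arbitrary smooth cut-off): if
  `(v₀, p₀, R₀)` and `(v₁, p₁, R₁)` solve the Navier–Stokes–Reynolds system with viscosity `ν`
  on `[0, T] × 𝕋^d` with mean-free velocities and `θ : ℝ → ℝ` is smooth on `[0, T]`, then
  `v_θ = (1-θ)v₀ + θv₁` solves it with the stress
  `R_θ = (1-θ)R₀ + θR₁ - θ(1-θ)(d ⊗̊ d) + ℛ(θ' d)`, `d = v₁ - v₀`, and an explicit pressure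
  (`Torus.IsNSReynoldsOn.glue`), together with the pointwise size of `R_θ` and of its first
  space and time derivatives in terms of those of the data.

## References

* T. Buckmaster, V. Vicol, Ann. of Math. 189 (2019) = arXiv:1709.10033, Prop. 2.1, §6.
  [`BuckmasterVicol2019Annals`]
* T. Buckmaster, C. De Lellis, L. Székelyhidi Jr., V. Vicol, CPAM 72 (2019) = arXiv:1701.08678,
  §4.1–4.2 (gluing in time, `∂ₜχ ℛ(vᵢ - vᵢ₊₁) - χ(1-χ)(vᵢ - vᵢ₊₁) ⊗̊ (vᵢ - vᵢ₊₁)`).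
  [`BuckmasterEtAl2018`]
* A. Cheskidov, X. Luo, Invent. Math. 229 (2022) = arXiv:2009.06596, §7.2 Def. 7.2 (`ℛ`).
  [`CheskidovLuo2022`]
-/

noncomputable section

open MeasureTheory Set Filter Topology Function
open scoped ContDiff InnerProductSpace

namespace Literature.Analysis.FluidPDE

namespace Torus

open FunctionSpaces FunctionSpaces.Torus

variable {d : Type*} [Fintype d] [DecidableEq d]

/-! ## `ℛ` commutes with space derivatives -/

section DerivComm

variable {v : UnitAddTorus d → EuclideanSpace ℝ d}

/-- `Δ⁻¹` of the coordinates of `∂ₗv` is `∂ₗ` of `Δ⁻¹` of the coordinates of `v`. [folklore] -/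
theorem antidivPotential_partialDeriv' (hv : IsSmooth v) (l j : d) :
    antidivPotential (FunctionSpaces.Torus.partialDeriv l v) j = FunctionSpaces.Torus.partialDeriv l (antidivPotential v j) := by
  have h1 : IsContDiff 1 v := hv.isContDiff (by simp)
  have hcoord : (fun x => FunctionSpaces.Torus.partialDeriv l v x j) = FunctionSpaces.Torus.partialDeriv l (fun x => v x j) := by
    funext x; rw [partialDeriv_apply_coord h1 l x j]
  funext x
  unfold antidivPotential
  rw [hcoord, partialDeriv_invLaplacian (hv.apply j) l x]

/-- `div Δ⁻¹ (∂ₗv) = ∂ₗ (div Δ⁻¹ v)`. [folklore] -/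
theorem antidivDiv_partialDeriv (hv : IsSmooth v) (l : d) :
    antidivDiv (FunctionSpaces.Torus.partialDeriv l v) = FunctionSpaces.Torus.partialDeriv l (antidivDiv v) := by
  funext x
  unfold antidivDiv
  simp_rw [antidivPotential_partialDeriv' hv l]
  rw [show (fun x => ∑ m, FunctionSpaces.Torus.partialDeriv m (antidivPotential v m) x) =
      fun x => ∑ m ∈ Finset.univ, FunctionSpaces.Torus.partialDeriv m (antidivPotential v m) x from rfl,
    partialDeriv_finset_sum _ fun m _ => ((isSmooth_antidivPotential hv m).partialDeriv m).isContDiff (by simp)]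
  exact Finset.sum_congr rfl fun m _ => partialDeriv_comm (isSmooth_antidivPotential hv m) m l x

/-- `Δ⁻¹ div Δ⁻¹ (∂ₗv) = ∂ₗ (Δ⁻¹ div Δ⁻¹ v)`. [folklore] -/
theorem antidivPhi_partialDeriv (hv : IsSmooth v) (l : d) :
    antidivPhi (FunctionSpaces.Torus.partialDeriv l v) = FunctionSpaces.Torus.partialDeriv l (antidivPhi v) := by
  funext x
  unfold antidivPhi
  rw [antidivDiv_partialDeriv hv l, partialDeriv_invLaplacian (isSmooth_antidivDiv hv) l x]

/-- Entrywise: `(ℛ ∂ₗv)ᵢⱼ = ∂ₗ (ℛv)ᵢⱼ`. [folklore] -/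
theorem antidivEntry_partialDeriv (hv : IsSmooth v) (i j l : d) (x : UnitAddTorus d) :
    antidivEntry (FunctionSpaces.Torus.partialDeriv l v) i j x = FunctionSpaces.Torus.partialDeriv l (antidivEntry v i j) x := by
  have hvl : IsSmooth (FunctionSpaces.Torus.partialDeriv l v) := hv.partialDeriv l
  have hu : ∀ j, IsSmooth (antidivPotential v j) := isSmooth_antidivPotential hv
  rw [partialDeriv_antidivEntry hv i j l x]
  unfold antidivEntry
  rw [antidivPotential_partialDeriv' hv l j, antidivPotential_partialDeriv' hv l i, antidivDiv_partialDeriv hv l,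
    antidivPhi_partialDeriv hv l, partialDeriv_comm (hu j) i l x, partialDeriv_comm (hu i) j l x]
  have e3 : FunctionSpaces.Torus.partialDeriv i (FunctionSpaces.Torus.partialDeriv j (FunctionSpaces.Torus.partialDeriv l (antidivPhi v))) x =
      FunctionSpaces.Torus.partialDeriv l (FunctionSpaces.Torus.partialDeriv i (FunctionSpaces.Torus.partialDeriv j (antidivPhi v))) x := by
    have hφ := isSmooth_antidivPhi hv
    have e1 : FunctionSpaces.Torus.partialDeriv j (FunctionSpaces.Torus.partialDeriv l (antidivPhi v)) = FunctionSpaces.Torus.partialDeriv l (FunctionSpaces.Torus.partialDeriv j (antidivPhi v)) :=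
      funext fun y => partialDeriv_comm hφ j l y
    rw [e1, partialDeriv_comm (hφ.partialDeriv j) i l x]
  rw [e3]

/-- **`ℛ` commutes with space derivatives**: `∂ₗ (ℛv)·eⱼ = (ℛ ∂ₗv)·eⱼ` column by column, for
smooth `v`. [cite: CheskidovLuo2022, §7.2 Def. 7.2] -/
theorem partialDeriv_antidivergence (hv : IsSmooth v) (l j : d) (x : UnitAddTorus d) :
    FunctionSpaces.Torus.partialDeriv l (fun y => antidivergence v y j) x = antidivergence (FunctionSpaces.Torus.partialDeriv l v) x j := by
  have h1 : IsContDiff 1 (fun y => antidivergence v y j) := ((isSmooth_antidivergence hv).column j).isContDiff (by simp)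
  ext i
  rw [← partialDeriv_apply_coord h1 l x i, antidivergence_apply, antidivEntry_partialDeriv hv i j l x]
  rfl

/-- `∂ₗ (ℛv) = ℛ(∂ₗv)` as tensor fields. [folklore] -/
theorem partialDeriv_antidivergence_tensor (hv : IsSmooth v) (l : d) (x : UnitAddTorus d) :
    FunctionSpaces.Torus.partialDeriv l (antidivergence v) x = antidivergence (FunctionSpaces.Torus.partialDeriv l v) x := by
  funext j
  rw [partialDeriv_tensor_apply (isSmooth_antidivergence hv) l x j, partialDeriv_antidivergence hv l j x]

/-- **Sup bound for space derivatives of `ℛv`**: with the constant `K` of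
`Torus.exists_norm_antidivergence_le`, `‖∂ₗ(ℛv)(x)‖ ≤ K C` whenever `‖∂ₗv‖ ≤ C`. [folklore] -/
theorem norm_partialDeriv_antidivergence_le {K : ℝ}
    (hK : ∀ (w : UnitAddTorus d → EuclideanSpace ℝ d), IsSmooth w → ∀ C : ℝ, 0 ≤ C → (∀ x, ‖w x‖ ≤ C) →
      ∀ x, ‖antidivergence w x‖ ≤ K * C)
    (hv : IsSmooth v) (l : d) {C : ℝ} (hC : 0 ≤ C) (hb : ∀ x, ‖FunctionSpaces.Torus.partialDeriv l v x‖ ≤ C) (x : UnitAddTorus d) :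
    ‖FunctionSpaces.Torus.partialDeriv l (antidivergence v) x‖ ≤ K * C := by
  rw [partialDeriv_antidivergence_tensor hv l x]
  exact hK _ (hv.partialDeriv l) C hC hb x

end DerivComm

/-! ## `ℛ` commutes with the one-sided time derivative -/

section TimeComm

variable {a b : ℝ} {f : ℝ → UnitAddTorus d → EuclideanSpace ℝ d}

omit [DecidableEq d] in
/-- The potentials of `ℛ f(t)` are jointly smooth. [folklore] -/
theorem isSmoothSpaceTimeOn_antidivPotential {S : Set ℝ} (hS : Convex ℝ S) (hSi : (interior S).Nonempty)
    (hf : FunctionSpaces.Torus.IsSmoothSpaceTimeOn S f) (j : d) : FunctionSpaces.Torus.IsSmoothSpaceTimeOn S (fun t => antidivPotential (f t) j) :=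
  (hf.apply j).invLaplacian hS hSi

/-- `div Δ⁻¹ f(t)` is jointly smooth. [folklore] -/
theorem isSmoothSpaceTimeOn_antidivDiv {S : Set ℝ} (hS : Convex ℝ S) (hSi : (interior S).Nonempty)
    (hf : FunctionSpaces.Torus.IsSmoothSpaceTimeOn S f) : FunctionSpaces.Torus.IsSmoothSpaceTimeOn S (fun t => antidivDiv (f t)) :=
  FunctionSpaces.Torus.IsSmoothSpaceTimeOn.sum fun l _ => (isSmoothSpaceTimeOn_antidivPotential hS hSi hf l).partialDeriv (uniqueDiffOn_convex hS hSi) l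

/-- `Δ⁻¹ div Δ⁻¹ f(t)` is jointly smooth. [folklore] -/
theorem isSmoothSpaceTimeOn_antidivPhi {S : Set ℝ} (hS : Convex ℝ S) (hSi : (interior S).Nonempty)
    (hf : FunctionSpaces.Torus.IsSmoothSpaceTimeOn S f) : FunctionSpaces.Torus.IsSmoothSpaceTimeOn S (fun t => antidivPhi (f t)) :=
  (isSmoothSpaceTimeOn_antidivDiv hS hSi hf).invLaplacian hS hSi

/-- `∂ₜ Δ⁻¹ fⱼ = Δ⁻¹ (∂ₜf)ⱼ`. [folklore] -/
theorem timeDerivWithin_antidivPotential (hab : a < b) (hf : FunctionSpaces.Torus.IsSmoothSpaceTimeOn (Icc a b) f) {t : ℝ} (ht : t ∈ Icc a b)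
    (j : d) : FunctionSpaces.Torus.timeDerivWithin (Icc a b) (fun s => antidivPotential (f s) j) t =
      antidivPotential (FunctionSpaces.Torus.timeDerivWithin (Icc a b) f t) j := by
  have hU : UniqueDiffOn ℝ (Icc a b) := uniqueDiffOn_Icc hab
  funext x
  unfold antidivPotential
  rw [timeDerivWithin_invLaplacian hab (hf.apply j) ht x]
  congr 1
  funext y
  exact timeDerivWithin_clm_comp hf hU (EuclideanSpace.proj j) ht y

/-- `∂ₜ (div Δ⁻¹ f) = div Δ⁻¹ (∂ₜf)`. [folklore] -/
theorem timeDerivWithin_antidivDiv (hab : a < b) (hf : FunctionSpaces.Torus.IsSmoothSpaceTimeOn (Icc a b) f) {t : ℝ} (ht : t ∈ Icc a b) :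
    FunctionSpaces.Torus.timeDerivWithin (Icc a b) (fun s => antidivDiv (f s)) t = antidivDiv (FunctionSpaces.Torus.timeDerivWithin (Icc a b) f t) := by
  have hU : UniqueDiffOn ℝ (Icc a b) := uniqueDiffOn_Icc hab
  have hcv : Convex ℝ (Icc a b) := convex_Icc a b
  have hint : (interior (Icc a b)).Nonempty := by rw [interior_Icc]; exact nonempty_Ioo.2 hab
  have hP := isSmoothSpaceTimeOn_antidivPotential hcv hint hf
  funext x
  unfold antidivDiv
  rw [show (fun s (y : UnitAddTorus d) => ∑ l, FunctionSpaces.Torus.partialDeriv l (antidivPotential (f s) l) y) =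
      fun s y => ∑ l ∈ Finset.univ, FunctionSpaces.Torus.partialDeriv l (antidivPotential (f s) l) y from rfl,
    timeDerivWithin_finset_sum _ (fun l _ => (hP l).partialDeriv hU l) hU ht x]
  refine Finset.sum_congr rfl fun l _ => ?_
  rw [timeDerivWithin_partialDeriv_comm hab (hP l) ht l x, timeDerivWithin_antidivPotential hab hf ht l]

/-- `∂ₜ (Δ⁻¹ div Δ⁻¹ f) = Δ⁻¹ div Δ⁻¹ (∂ₜf)`. [folklore] -/
theorem timeDerivWithin_antidivPhi (hab : a < b) (hf : FunctionSpaces.Torus.IsSmoothSpaceTimeOn (Icc a b) f) {t : ℝ} (ht : t ∈ Icc a b) :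
    FunctionSpaces.Torus.timeDerivWithin (Icc a b) (fun s => antidivPhi (f s)) t = antidivPhi (FunctionSpaces.Torus.timeDerivWithin (Icc a b) f t) := by
  have hcv : Convex ℝ (Icc a b) := convex_Icc a b
  have hint : (interior (Icc a b)).Nonempty := by rw [interior_Icc]; exact nonempty_Ioo.2 hab
  funext x
  unfold antidivPhi
  rw [timeDerivWithin_invLaplacian hab (isSmoothSpaceTimeOn_antidivDiv hcv hint hf) ht x, timeDerivWithin_antidivDiv hab hf ht]

/-- Entrywise: `∂ₜ (ℛ f)ᵢⱼ = (ℛ ∂ₜf)ᵢⱼ`. [folklore] -/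
theorem timeDerivWithin_antidivEntry (hab : a < b) (hf : FunctionSpaces.Torus.IsSmoothSpaceTimeOn (Icc a b) f) {t : ℝ} (ht : t ∈ Icc a b)
    (i j : d) (x : UnitAddTorus d) :
    FunctionSpaces.Torus.timeDerivWithin (Icc a b) (fun s => antidivEntry (f s) i j) t x = antidivEntry (FunctionSpaces.Torus.timeDerivWithin (Icc a b) f t) i j x := by
  have hU : UniqueDiffOn ℝ (Icc a b) := uniqueDiffOn_Icc hab
  have hcv : Convex ℝ (Icc a b) := convex_Icc a b
  have hint : (interior (Icc a b)).Nonempty := by rw [interior_Icc]; exact nonempty_Ioo.2 hab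
  have hP := isSmoothSpaceTimeOn_antidivPotential hcv hint hf
  have hD := isSmoothSpaceTimeOn_antidivDiv hcv hint hf
  have hΦ := isSmoothSpaceTimeOn_antidivPhi hcv hint hf
  have hA : FunctionSpaces.Torus.IsSmoothSpaceTimeOn (Icc a b) (fun s => FunctionSpaces.Torus.partialDeriv i (antidivPotential (f s) j)) := (hP j).partialDeriv hU i
  have hB : FunctionSpaces.Torus.IsSmoothSpaceTimeOn (Icc a b) (fun s => FunctionSpaces.Torus.partialDeriv j (antidivPotential (f s) i)) := (hP i).partialDeriv hU j
  have hite : FunctionSpaces.Torus.IsSmoothSpaceTimeOn (Icc a b) (fun s y => if i = j then antidivDiv (f s) y else 0) := by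
    by_cases hij : i = j
    · simp only [if_pos hij]; exact hD
    · simp only [if_neg hij]; exact isSmoothSpaceTimeOn_const (isSmooth_const _) _
  have hE : FunctionSpaces.Torus.IsSmoothSpaceTimeOn (Icc a b) (fun s => FunctionSpaces.Torus.partialDeriv i (FunctionSpaces.Torus.partialDeriv j (antidivPhi (f s)))) :=
    (hΦ.partialDeriv hU j).partialDeriv hU i
  set c₁ : ℝ := 1 / ((Fintype.card d : ℝ) - 1) with hc₁
  set c₂ : ℝ := (2 - (Fintype.card d : ℝ)) / ((Fintype.card d : ℝ) - 1) with hc₂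
  have e0 : (fun s => antidivEntry (f s) i j) = fun s y =>
      ((FunctionSpaces.Torus.partialDeriv i (antidivPotential (f s) j) y + FunctionSpaces.Torus.partialDeriv j (antidivPotential (f s) i) y) -
        c₁ • (if i = j then antidivDiv (f s) y else 0)) + c₂ • FunctionSpaces.Torus.partialDeriv i (FunctionSpaces.Torus.partialDeriv j (antidivPhi (f s))) y := by
    funext s y; simp only [antidivEntry, smul_eq_mul]; rfl
  rw [e0, timeDerivWithin_add ((hA.add hB).sub (hite.const_smul c₁)) (hE.const_smul c₂) hU ht x,
    timeDerivWithin_const_smul hE hU c₂ ht x]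
  have e1 : FunctionSpaces.Torus.timeDerivWithin (Icc a b) (fun s y => (FunctionSpaces.Torus.partialDeriv i (antidivPotential (f s) j) y +
      FunctionSpaces.Torus.partialDeriv j (antidivPotential (f s) i) y) - c₁ • (if i = j then antidivDiv (f s) y else 0)) t x =
      FunctionSpaces.Torus.timeDerivWithin (Icc a b) (fun s y => FunctionSpaces.Torus.partialDeriv i (antidivPotential (f s) j) y + FunctionSpaces.Torus.partialDeriv j (antidivPotential (f s) i) y) t x -
        FunctionSpaces.Torus.timeDerivWithin (Icc a b) (fun s y => c₁ • (if i = j then antidivDiv (f s) y else 0)) t x := by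
    unfold FunctionSpaces.Torus.timeDerivWithin
    exact (((hA.add hB).hasDerivWithinAt_slice ht x).sub ((hite.const_smul c₁).hasDerivWithinAt_slice ht x)).derivWithin (hU t ht)
  rw [e1, timeDerivWithin_add hA hB hU ht x, timeDerivWithin_const_smul hite hU c₁ ht x,
    timeDerivWithin_partialDeriv_comm hab (hP j) ht i x, timeDerivWithin_partialDeriv_comm hab (hP i) ht j x,
    timeDerivWithin_antidivPotential hab hf ht j, timeDerivWithin_antidivPotential hab hf ht i,
    timeDerivWithin_partialDeriv_comm hab (hΦ.partialDeriv hU j) ht i x]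
  have e2 : FunctionSpaces.Torus.timeDerivWithin (Icc a b) (fun s => FunctionSpaces.Torus.partialDeriv j (antidivPhi (f s))) t =
      FunctionSpaces.Torus.partialDeriv j (antidivPhi (FunctionSpaces.Torus.timeDerivWithin (Icc a b) f t)) := by
    funext y; rw [timeDerivWithin_partialDeriv_comm hab hΦ ht j y, timeDerivWithin_antidivPhi hab hf ht]
  have e3 : FunctionSpaces.Torus.timeDerivWithin (Icc a b) (fun s y => if i = j then antidivDiv (f s) y else 0) t x =
      if i = j then antidivDiv (FunctionSpaces.Torus.timeDerivWithin (Icc a b) f t) x else 0 := by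
    by_cases hij : i = j
    · simp only [if_pos hij]
      rw [show FunctionSpaces.Torus.timeDerivWithin (Icc a b) (fun s y => antidivDiv (f s) y) t x = FunctionSpaces.Torus.timeDerivWithin (Icc a b) (fun s => antidivDiv (f s)) t x
        from rfl, timeDerivWithin_antidivDiv hab hf ht]
    · simp only [if_neg hij]
      unfold FunctionSpaces.Torus.timeDerivWithin
      exact congr_fun (derivWithin_fun_const (s := Icc a b) (c := (0 : ℝ))) t
  rw [e2, e3]
  simp only [antidivEntry, smul_eq_mul]
  rfl

/-- **`ℛ` commutes with the one-sided time derivative**: for `f` jointly smooth on `[a, b] × 𝕋^d`,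
`∂ₜ (ℛ f(t)) eⱼ = (ℛ ∂ₜf(t)) eⱼ`. [cite: CheskidovLuo2022, §7.2 Def. 7.2] -/
theorem timeDerivWithin_antidivergence (hab : a < b) (hf : FunctionSpaces.Torus.IsSmoothSpaceTimeOn (Icc a b) f) {t : ℝ} (ht : t ∈ Icc a b)
    (x : UnitAddTorus d) (j : d) :
    FunctionSpaces.Torus.timeDerivWithin (Icc a b) (fun s y => antidivergence (f s) y j) t x = antidivergence (FunctionSpaces.Torus.timeDerivWithin (Icc a b) f t) x j := by
  have hU : UniqueDiffOn ℝ (Icc a b) := uniqueDiffOn_Icc hab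
  have hcv : Convex ℝ (Icc a b) := convex_Icc a b
  have hint : (interior (Icc a b)).Nonempty := by rw [interior_Icc]; exact nonempty_Ioo.2 hab
  have hcol : FunctionSpaces.Torus.IsSmoothSpaceTimeOn (Icc a b) (fun s y => antidivergence (f s) y j) := by
    have h := hf.antidivergence hcv hint
    exact h.clm_comp (ContinuousLinearMap.proj (R := ℝ) (φ := fun _ : d => EuclideanSpace ℝ d) j)
  ext i
  have h1 : (FunctionSpaces.Torus.timeDerivWithin (Icc a b) (fun s y => antidivergence (f s) y j) t x) i =
      FunctionSpaces.Torus.timeDerivWithin (Icc a b) (fun s y => antidivergence (f s) y j i) t x :=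
    (timeDerivWithin_clm_comp hcol hU (EuclideanSpace.proj i) ht x).symm
  rw [h1, antidivergence_apply]
  simp only [antidivergence_apply]
  exact timeDerivWithin_antidivEntry hab hf ht i j x

/-- `∂ₜ (ℛ f(t)) = ℛ (∂ₜ f(t))` as tensor fields. [folklore] -/
theorem timeDerivWithin_antidivergence_tensor (hab : a < b) (hf : FunctionSpaces.Torus.IsSmoothSpaceTimeOn (Icc a b) f) {t : ℝ}
    (ht : t ∈ Icc a b) (x : UnitAddTorus d) :
    FunctionSpaces.Torus.timeDerivWithin (Icc a b) (fun s => antidivergence (f s)) t x = antidivergence (FunctionSpaces.Torus.timeDerivWithin (Icc a b) f t) x := by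
  have hU : UniqueDiffOn ℝ (Icc a b) := uniqueDiffOn_Icc hab
  have hcv : Convex ℝ (Icc a b) := convex_Icc a b
  have hint : (interior (Icc a b)).Nonempty := by rw [interior_Icc]; exact nonempty_Ioo.2 hab
  have hA := hf.antidivergence hcv hint
  funext j
  have h1 : FunctionSpaces.Torus.timeDerivWithin (Icc a b) (fun s => antidivergence (f s)) t x j =
      FunctionSpaces.Torus.timeDerivWithin (Icc a b) (fun s y => antidivergence (f s) y j) t x :=
    (timeDerivWithin_clm_comp hA hU (ContinuousLinearMap.proj (R := ℝ) (φ := fun _ : d => EuclideanSpace ℝ d) j) ht x).symm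
  rw [h1, timeDerivWithin_antidivergence hab hf ht x j]

/-- **Sup bound for the time derivative of `ℛ f(t)`**: `‖∂ₜ(ℛf)(t,x)‖ ≤ K C` whenever
`‖∂ₜ f(t, ·)‖ ≤ C`. [folklore] -/
theorem norm_timeDerivWithin_antidivergence_le {K : ℝ}
    (hK : ∀ (w : UnitAddTorus d → EuclideanSpace ℝ d), IsSmooth w → ∀ C : ℝ, 0 ≤ C → (∀ x, ‖w x‖ ≤ C) →
      ∀ x, ‖antidivergence w x‖ ≤ K * C)
    (hab : a < b) (hf : FunctionSpaces.Torus.IsSmoothSpaceTimeOn (Icc a b) f) {t : ℝ} (ht : t ∈ Icc a b) {C : ℝ} (hC : 0 ≤ C)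
    (hb : ∀ x, ‖FunctionSpaces.Torus.timeDerivWithin (Icc a b) f t x‖ ≤ C) (x : UnitAddTorus d) :
    ‖FunctionSpaces.Torus.timeDerivWithin (Icc a b) (fun s => antidivergence (f s)) t x‖ ≤ K * C := by
  rw [timeDerivWithin_antidivergence_tensor hab hf ht x]
  exact hK _ (hf.isSmooth_timeDerivWithin (uniqueDiffOn_Icc hab) ht) C hC hb x

end TimeComm

/-! ## Time-only functions as space–time fields -/

section TimeOnly

omit [DecidableEq d]

/-- A function of time alone, smooth on the time set, is a jointly smooth space–time field. [folklore] -/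
theorem isSmoothSpaceTimeOn_time {S : Set ℝ} {θ : ℝ → ℝ} (hθ : ContDiffOn ℝ ∞ θ S) :
    FunctionSpaces.Torus.IsSmoothSpaceTimeOn S (fun t (_ : UnitAddTorus d) => θ t) :=
  hθ.comp contDiff_fst.contDiffOn fun _ hp => (mem_prod.1 hp).1

omit [Fintype d] in
/-- Its one-sided time derivative is `derivWithin`. [folklore] -/
theorem timeDerivWithin_time (S : Set ℝ) (θ : ℝ → ℝ) (t : ℝ) (x : UnitAddTorus d) :
    FunctionSpaces.Torus.timeDerivWithin S (fun t (_ : UnitAddTorus d) => θ t) t x = derivWithin θ S t := rfl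

/-- The derivative within `[0, T]` of a function smooth on `[0, T]` is smooth on `[0, T]`. [folklore] -/
theorem contDiffOn_derivWithin_Icc {T : ℝ} (hT : 0 < T) {θ : ℝ → ℝ} (hθ : ContDiffOn ℝ ∞ θ (Icc 0 T)) :
    ContDiffOn ℝ ∞ (derivWithin θ (Icc 0 T)) (Icc 0 T) :=
  hθ.derivWithin (uniqueDiffOn_Icc hT) (by simp)

end TimeOnly

/-! ## Gluing two Navier–Stokes–Reynolds triples in time -/

section Glue

variable (T : ℝ) (θ : ℝ → ℝ) (v₀ v₁ : ℝ → UnitAddTorus d → EuclideanSpace ℝ d) (p₀ p₁ : ℝ → UnitAddTorus d → ℝ)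
  (R₀ R₁ : ℝ → UnitAddTorus d → d → EuclideanSpace ℝ d)

omit [DecidableEq d] in
/-- **The glued velocity** `v_θ = (1-θ)v₀ + θv₁`. [cite: BuckmasterEtAl2018, §4.1] -/
def glueVel (t : ℝ) (y : UnitAddTorus d) : EuclideanSpace ℝ d := (1 - θ t) • v₀ t y + θ t • v₁ t y

omit [DecidableEq d] in
/-- The difference `d = v₁ - v₀`. [folklore] -/
def glueDiff (t : ℝ) (y : UnitAddTorus d) : EuclideanSpace ℝ d := v₁ t y - v₀ t y

/-- The one-sided derivative `θ'` of the cut-off within `[0, T]`. [folklore] -/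
def glueRate (t : ℝ) : ℝ := derivWithin θ (Icc 0 T) t

/-- **The glued Reynolds stress**
`R_θ = (1-θ)R₀ + θR₁ - θ(1-θ)(d ⊗̊ d) + ℛ(θ' d)`. [cite: BuckmasterEtAl2018, §4.2] -/
def glueStress (t : ℝ) (y : UnitAddTorus d) (j : d) : EuclideanSpace ℝ d :=
  (1 - θ t) • R₀ t y j + θ t • R₁ t y j - (θ t * (1 - θ t)) • tracelessSq (glueDiff v₀ v₁ t) y j +
    antidivergence (fun z => glueRate T θ t • glueDiff v₀ v₁ t z) y j

omit [DecidableEq d] in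
/-- **The glued pressure** `p_θ = (1-θ)p₀ + θp₁ + θ(1-θ)(|d|²/d - ⨍|d|²/d)`. [cite: BuckmasterEtAl2018, §4.2] -/
def gluePres (t : ℝ) (y : UnitAddTorus d) : ℝ :=
  (1 - θ t) * p₀ t y + θ t * p₁ t y +
    θ t * (1 - θ t) * (‖glueDiff v₀ v₁ t y‖ ^ 2 / Fintype.card d - ∫ z, ‖glueDiff v₀ v₁ t z‖ ^ 2 / Fintype.card d)

variable {T θ v₀ v₁ p₀ p₁ R₀ R₁} {ν : ℝ}

omit [Fintype d] [DecidableEq d] in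
/-- Where `θ = 0` the glued velocity is `v₀`. [folklore] -/
theorem glueVel_of_eq_zero {t : ℝ} (h : θ t = 0) : glueVel θ v₀ v₁ t = v₀ t := by
  funext y; simp [glueVel, h]

omit [Fintype d] [DecidableEq d] in
/-- Where `θ = 1` the glued velocity is `v₁`. [folklore] -/
theorem glueVel_of_eq_one {t : ℝ} (h : θ t = 1) : glueVel θ v₀ v₁ t = v₁ t := by
  funext y; simp [glueVel, h]

omit [Fintype d] [DecidableEq d] in
/-- `v_θ = v₀ + θ d`. [folklore] -/
theorem glueVel_eq_add (t : ℝ) (y : UnitAddTorus d) : glueVel θ v₀ v₁ t y = v₀ t y + θ t • glueDiff v₀ v₁ t y := by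
  simp only [glueVel, glueDiff, smul_sub, sub_smul, one_smul]; abel

/-- Where `θ = 0` and `θ' = 0` the glued stress is `R₀`. [folklore] -/
theorem glueStress_of_eq_zero {t : ℝ} (h : θ t = 0) (h' : glueRate T θ t = 0) : glueStress T θ v₀ v₁ R₀ R₁ t = R₀ t := by
  funext y j
  simp only [glueStress, h, h', sub_zero, one_smul, zero_smul, add_zero, zero_mul]
  rw [show (fun _ : UnitAddTorus d => (0 : EuclideanSpace ℝ d)) = 0 from rfl, antidivergence_zero]
  simp

/-- Where `θ = 1` and `θ' = 0` the glued stress is `R₁`. [folklore] -/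
theorem glueStress_of_eq_one {t : ℝ} (h : θ t = 1) (h' : glueRate T θ t = 0) : glueStress T θ v₀ v₁ R₀ R₁ t = R₁ t := by
  funext y j
  simp only [glueStress, h, h', sub_self, one_smul, zero_smul, zero_add, mul_zero, sub_zero]
  rw [show (fun _ : UnitAddTorus d => (0 : EuclideanSpace ℝ d)) = 0 from rfl, antidivergence_zero]
  simp

variable (h₀ : IsNSReynoldsOn (Icc 0 T) ν v₀ p₀ R₀) (h₁ : IsNSReynoldsOn (Icc 0 T) ν v₁ p₁ R₁) (hT : 0 < T)
  (hθ : ContDiffOn ℝ ∞ θ (Icc 0 T))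
include h₀ h₁ hT hθ

omit hT hθ in
/-- Joint smoothness of `d`. [folklore] -/
theorem smooth_glueDiff : FunctionSpaces.Torus.IsSmoothSpaceTimeOn (Icc 0 T) (glueDiff v₀ v₁) :=
  h₁.smooth_velocity.sub h₀.smooth_velocity

omit hT in
/-- Joint smoothness of `v_θ`. [folklore] -/
theorem smooth_glueVel : FunctionSpaces.Torus.IsSmoothSpaceTimeOn (Icc 0 T) (glueVel θ v₀ v₁) := by
  have hθ' : FunctionSpaces.Torus.IsSmoothSpaceTimeOn (Icc 0 T) (fun t (_ : UnitAddTorus d) => 1 - θ t) :=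
    isSmoothSpaceTimeOn_time (contDiffOn_const.sub hθ)
  exact (hθ'.smul h₀.smooth_velocity).add ((isSmoothSpaceTimeOn_time hθ).smul h₁.smooth_velocity)

/-- Joint smoothness of `θ' d`. [folklore] -/
theorem smooth_rate_smul_glueDiff :
    FunctionSpaces.Torus.IsSmoothSpaceTimeOn (Icc 0 T) (fun t z => glueRate T θ t • glueDiff v₀ v₁ t z) :=
  (isSmoothSpaceTimeOn_time (contDiffOn_derivWithin_Icc hT hθ)).smul (smooth_glueDiff h₀ h₁)

omit h₀ h₁ hT hθ in
/-- `u ⊗̊ u` is jointly smooth for jointly smooth `u`. [folklore] -/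
theorem isSmoothSpaceTimeOn_tracelessSq' {S : Set ℝ} {u : ℝ → UnitAddTorus d → EuclideanSpace ℝ d}
    (hu : FunctionSpaces.Torus.IsSmoothSpaceTimeOn S u) :
    FunctionSpaces.Torus.IsSmoothSpaceTimeOn S (fun t => tracelessSq (u t)) := by
  have hsq : FunctionSpaces.Torus.IsSmoothSpaceTimeOn S (fun t y => ‖u t y‖ ^ 2 / Fintype.card d) := by
    have h := hu.inner hu
    have e : (fun t y => ‖u t y‖ ^ 2 / Fintype.card d) = fun t y => ⟪u t y, u t y⟫_ℝ * (1 / Fintype.card d) := by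
      funext t y; rw [real_inner_self_eq_norm_sq]; ring
    rw [e]
    exact h.mul (isSmoothSpaceTimeOn_const (isSmooth_const _) _)
  refine isSmoothSpaceTimeOn_tensor_iff.2 fun j => ?_
  exact ((hu.apply j).smul hu).sub (hsq.smul (isSmoothSpaceTimeOn_const (isSmooth_const _) S))

/-- Joint smoothness of `R_θ`. [folklore] -/
theorem smooth_glueStress : FunctionSpaces.Torus.IsSmoothSpaceTimeOn (Icc 0 T) (glueStress T θ v₀ v₁ R₀ R₁) := by
  have hcv : Convex ℝ (Icc (0 : ℝ) T) := convex_Icc 0 T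
  have hint : (interior (Icc (0 : ℝ) T)).Nonempty := by rw [interior_Icc]; exact nonempty_Ioo.2 hT
  have hdd : FunctionSpaces.Torus.IsSmoothSpaceTimeOn (Icc 0 T) (fun t => tracelessSq (glueDiff v₀ v₁ t)) :=
    isSmoothSpaceTimeOn_tracelessSq' (smooth_glueDiff h₀ h₁)
  have hprod : FunctionSpaces.Torus.IsSmoothSpaceTimeOn (Icc 0 T) (fun t (_ : UnitAddTorus d) => θ t * (1 - θ t)) :=
    isSmoothSpaceTimeOn_time (hθ.mul (contDiffOn_const.sub hθ))
  have h1 : FunctionSpaces.Torus.IsSmoothSpaceTimeOn (Icc 0 T) (fun t y j => (1 - θ t) • R₀ t y j) :=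
    (isSmoothSpaceTimeOn_time (contDiffOn_const.sub hθ)).smul h₀.smooth_stress
  have h2 : FunctionSpaces.Torus.IsSmoothSpaceTimeOn (Icc 0 T) (fun t y j => θ t • R₁ t y j) :=
    (isSmoothSpaceTimeOn_time hθ).smul h₁.smooth_stress
  have h3 : FunctionSpaces.Torus.IsSmoothSpaceTimeOn (Icc 0 T) (fun t y j => (θ t * (1 - θ t)) • tracelessSq (glueDiff v₀ v₁ t) y j) :=
    hprod.smul hdd
  have h4 := (smooth_rate_smul_glueDiff h₀ h₁ hT hθ).antidivergence hcv hint
  exact ((h1.add h2).sub h3).add h4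

/-- Joint smoothness of `p_θ`. [folklore] -/
theorem smooth_gluePres : FunctionSpaces.Torus.IsSmoothSpaceTimeOn (Icc 0 T) (gluePres θ v₀ v₁ p₀ p₁) := by
  have hU : UniqueDiffOn ℝ (Icc (0 : ℝ) T) := uniqueDiffOn_Icc hT
  have hcv : Convex ℝ (Icc (0 : ℝ) T) := convex_Icc 0 T
  have hsq : FunctionSpaces.Torus.IsSmoothSpaceTimeOn (Icc 0 T) (fun t y => ‖glueDiff v₀ v₁ t y‖ ^ 2 / Fintype.card d) := by
    have h := (smooth_glueDiff h₀ h₁).inner (smooth_glueDiff h₀ h₁)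
    have e : (fun t y => ‖glueDiff v₀ v₁ t y‖ ^ 2 / Fintype.card d) =
        fun t y => ⟪glueDiff v₀ v₁ t y, glueDiff v₀ v₁ t y⟫_ℝ * (1 / Fintype.card d) := by
      funext t y; rw [real_inner_self_eq_norm_sq]; ring
    rw [e]
    exact h.mul (isSmoothSpaceTimeOn_const (isSmooth_const _) _)
  have hprod : FunctionSpaces.Torus.IsSmoothSpaceTimeOn (Icc 0 T) (fun t (_ : UnitAddTorus d) => θ t * (1 - θ t)) :=
    isSmoothSpaceTimeOn_time (hθ.mul (contDiffOn_const.sub hθ))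
  have h1 : FunctionSpaces.Torus.IsSmoothSpaceTimeOn (Icc 0 T) (fun t y => (1 - θ t) * p₀ t y) :=
    (isSmoothSpaceTimeOn_time (contDiffOn_const.sub hθ)).mul h₀.smooth_pressure
  have h2 : FunctionSpaces.Torus.IsSmoothSpaceTimeOn (Icc 0 T) (fun t y => θ t * p₁ t y) :=
    (isSmoothSpaceTimeOn_time hθ).mul h₁.smooth_pressure
  exact (h1.add h2).add (hprod.mul (hsq.sub (hsq.integral_const hU hcv)))

/-- **Gluing two Navier–Stokes–Reynolds triples in time.** Let `(v₀, p₀, R₀)` and `(v₁, p₁, R₁)`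
solve the NSR system with viscosity `ν` on `[0, T] × 𝕋^d` (`T > 0`, `d ≥ 2`) with velocities of
zero mean, and let `θ` be smooth on `[0, T]`. Then
`(v_θ, p_θ, R_θ) = ((1-θ)v₀ + θv₁, gluePres, glueStress)` solves the NSR system with viscosity
`ν` on `[0, T]`: with `d = v₁ - v₀`,
`∂ₜv_θ + div(v_θ ⊗ v_θ) - (1-θ)(∂ₜv₀ + div(v₀ ⊗ v₀)) - θ(∂ₜv₁ + div(v₁ ⊗ v₁)) = θ' d - θ(1-θ) div(d ⊗ d)`,
`div ℛ(θ'd) = θ'd` (`∫ d = 0`) and `div(d ⊗̊ d) = div(d ⊗ d) - ∇|d|²/d`. [cite: BuckmasterEtAl2018, §4.1–4.2] -/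
theorem IsNSReynoldsOn.glue (hd : 2 ≤ Fintype.card d) (hm₀ : ∀ t ∈ Icc 0 T, HasZeroMean (v₀ t))
    (hm₁ : ∀ t ∈ Icc 0 T, HasZeroMean (v₁ t)) :
    IsNSReynoldsOn (Icc 0 T) ν (glueVel θ v₀ v₁) (gluePres θ v₀ v₁ p₀ p₁) (glueStress T θ v₀ v₁ R₀ R₁) := by
  haveI : Nonempty d := Fintype.card_pos_iff.1 (by omega)
  have hU : UniqueDiffOn ℝ (Icc (0 : ℝ) T) := uniqueDiffOn_Icc hT
  have hcv : Convex ℝ (Icc (0 : ℝ) T) := convex_Icc 0 T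
  have hint : (interior (Icc (0 : ℝ) T)).Nonempty := by rw [interior_Icc]; exact nonempty_Ioo.2 hT
  have hdst := smooth_glueDiff h₀ h₁
  have hrd := smooth_rate_smul_glueDiff h₀ h₁ hT hθ
  refine
    { smooth_velocity := smooth_glueVel h₀ h₁ hθ
      smooth_pressure := smooth_gluePres h₀ h₁ hT hθ
      smooth_stress := smooth_glueStress h₀ h₁ hT hθ
      momentum := ?_
      divFree := ?_
      symm := ?_
      traceFree := ?_
      hasZeroMean_pressure := ?_ }
  · -- the momentum equation
    intro t ht y
    have hv₀ : IsSmooth (v₀ t) := h₀.smooth_velocity.isSmooth_slice ht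
    have hv₁ : IsSmooth (v₁ t) := h₁.smooth_velocity.isSmooth_slice ht
    have hdt : IsSmooth (glueDiff v₀ v₁ t) := hdst.isSmooth_slice ht
    have hp₀ : IsSmooth (p₀ t) := h₀.smooth_pressure.isSmooth_slice ht
    have hp₁ : IsSmooth (p₁ t) := h₁.smooth_pressure.isSmooth_slice ht
    have hR₀ : IsSmooth (R₀ t) := h₀.smooth_stress.isSmooth_slice ht
    have hR₁ : IsSmooth (R₁ t) := h₁.smooth_stress.isSmooth_slice ht
    have c1v₀ : IsContDiff 1 (v₀ t) := hv₀.isContDiff (by simp)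
    have c1v₁ : IsContDiff 1 (v₁ t) := hv₁.isContDiff (by simp)
    set a : ℝ := θ t with ha
    set a' : ℝ := glueRate T θ t with ha'
    -- (1) time derivative
    have hθd : HasDerivWithinAt θ a' (Icc 0 T) t := (hθ.differentiableOn (by simp) t ht).hasDerivWithinAt
    have eDt : FunctionSpaces.Torus.timeDerivWithin (Icc 0 T) (glueVel θ v₀ v₁) t y =
        (1 - a) • FunctionSpaces.Torus.timeDerivWithin (Icc 0 T) v₀ t y + a • FunctionSpaces.Torus.timeDerivWithin (Icc 0 T) v₁ t y +
          a' • glueDiff v₀ v₁ t y := by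
      have k₀ := h₀.smooth_velocity.hasDerivWithinAt_slice ht y
      have k₁ := h₁.smooth_velocity.hasDerivWithinAt_slice ht y
      have k1θ : HasDerivWithinAt (fun s => 1 - θ s) (0 - a') (Icc 0 T) t := (hasDerivWithinAt_const t (Icc 0 T) (1 : ℝ)).sub hθd
      have key : HasDerivWithinAt (fun τ => glueVel θ v₀ v₁ τ y)
          ((1 - θ t) • FunctionSpaces.Torus.timeDerivWithin (Icc 0 T) v₀ t y + (0 - a') • v₀ t y +
            (θ t • FunctionSpaces.Torus.timeDerivWithin (Icc 0 T) v₁ t y + a' • v₁ t y)) (Icc 0 T) t :=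
        (k1θ.smul k₀).add (hθd.smul k₁)
      have e := key.derivWithin (hU t ht)
      unfold FunctionSpaces.Torus.timeDerivWithin at e ⊢
      rw [e]
      simp only [glueDiff, smul_sub, zero_sub, neg_smul, ha, ha']
      abel
    -- (2) convective term
    have eC : FunctionSpaces.Torus.convect (glueVel θ v₀ v₁ t) (glueVel θ v₀ v₁ t) y =
        (1 - a) • ((1 - a) • FunctionSpaces.Torus.convect (v₀ t) (v₀ t) y + a • FunctionSpaces.Torus.convect (v₀ t) (v₁ t) y) +
          a • ((1 - a) • FunctionSpaces.Torus.convect (v₁ t) (v₀ t) y + a • FunctionSpaces.Torus.convect (v₁ t) (v₁ t) y) := by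
      have e1 : glueVel θ v₀ v₁ t = fun z => (fun z => (1 - a) • v₀ t z) z + (fun z => a • v₁ t z) z := by
        funext z; simp [glueVel, ha]
      have c0 : IsContDiff 1 (fun z => (1 - a) • v₀ t z) := (hv₀.smul (1 - a)).isContDiff (by simp)
      have c1 : IsContDiff 1 (fun z => a • v₁ t z) := (hv₁.smul a).isContDiff (by simp)
      rw [e1, convect_add_left, convect_smul_left, convect_smul_left, convect_add_right _ c0 c1, convect_add_right _ c0 c1,
        convect_smul_right _ c1v₀, convect_smul_right _ c1v₁, convect_smul_right _ c1v₀, convect_smul_right _ c1v₁]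
    have eCd : FunctionSpaces.Torus.convect (glueDiff v₀ v₁ t) (glueDiff v₀ v₁ t) y =
        FunctionSpaces.Torus.convect (v₁ t) (v₁ t) y - FunctionSpaces.Torus.convect (v₁ t) (v₀ t) y - (FunctionSpaces.Torus.convect (v₀ t) (v₁ t) y - FunctionSpaces.Torus.convect (v₀ t) (v₀ t) y) := by
      have e1 : glueDiff v₀ v₁ t = fun z => (fun z => v₁ t z) z + (fun z => (-1 : ℝ) • v₀ t z) z := by
        funext z; simp [glueDiff, sub_eq_add_neg]
      have c0 : IsContDiff 1 (fun z => (-1 : ℝ) • v₀ t z) := (hv₀.smul (-1)).isContDiff (by simp)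
      rw [e1, convect_add_left, convect_smul_left, convect_add_right _ c1v₁ c0, convect_add_right _ c1v₁ c0,
        convect_smul_right _ c1v₀, convect_smul_right _ c1v₀]
      simp only [neg_smul, one_smul, smul_add, smul_neg]
      abel
    -- (3) pressure gradient
    have hsq : IsSmooth (fun z => ‖glueDiff v₀ v₁ t z‖ ^ 2 / Fintype.card d) := ContDiff.div_const hdt.norm_sq _
    have eG : FunctionSpaces.Torus.gradient (gluePres θ v₀ v₁ p₀ p₁ t) y =
        (1 - a) • FunctionSpaces.Torus.gradient (p₀ t) y + a • FunctionSpaces.Torus.gradient (p₁ t) y +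
          (a * (1 - a)) • FunctionSpaces.Torus.gradient (fun z => ‖glueDiff v₀ v₁ t z‖ ^ 2 / Fintype.card d) y := by
      set m : ℝ := ∫ z, ‖glueDiff v₀ v₁ t z‖ ^ 2 / Fintype.card d with hm
      have e1 : gluePres θ v₀ v₁ p₀ p₁ t = fun z => ((1 - a) * p₀ t z + a * p₁ t z) +
          ((a * (1 - a)) * (‖glueDiff v₀ v₁ t z‖ ^ 2 / Fintype.card d) + (-(a * (1 - a) * m))) := by
        funext z; simp only [gluePres, ha, hm]; ring
      have s0 : IsSmooth (fun z => (1 - a) * p₀ t z) := contDiff_const.mul hp₀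
      have s1 : IsSmooth (fun z => a * p₁ t z) := contDiff_const.mul hp₁
      have s2 : IsSmooth (fun z => (a * (1 - a)) * (‖glueDiff v₀ v₁ t z‖ ^ 2 / Fintype.card d)) := contDiff_const.mul hsq
      have c0 : IsContDiff 1 (fun z => (1 - a) * p₀ t z) := s0.isContDiff (by simp)
      have c1 : IsContDiff 1 (fun z => a * p₁ t z) := s1.isContDiff (by simp)
      have c01 : IsContDiff 1 (fun z => (1 - a) * p₀ t z + a * p₁ t z) := (s0.add s1).isContDiff (by simp)
      have c2 : IsContDiff 1 (fun z => (a * (1 - a)) * (‖glueDiff v₀ v₁ t z‖ ^ 2 / Fintype.card d) + (-(a * (1 - a) * m))) :=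
        (s2.add (isSmooth_const _)).isContDiff (by simp)
      rw [e1, gradient_add_apply c01 c2, gradient_add_apply c0 c1, gradient_const_mul_apply (hp₀.isContDiff (by simp)),
        gradient_const_mul_apply (hp₁.isContDiff (by simp)), gradient_add_apply (s2.isContDiff (by simp)) (isContDiff_const _),
        gradient_const, gradient_const_mul_apply (hsq.isContDiff (by simp))]
      simp
    -- (4) Laplacian
    have eL : FunctionSpaces.Torus.laplacian (glueVel θ v₀ v₁ t) y = (1 - a) • FunctionSpaces.Torus.laplacian (v₀ t) y + a • FunctionSpaces.Torus.laplacian (v₁ t) y := by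
      have e1 : glueVel θ v₀ v₁ t = fun z => ((1 - a) • v₀ t) z + (a • v₁ t) z := by funext z; simp [glueVel, ha]
      rw [e1, laplacian_add_apply (hv₀.smul (1 - a)) (hv₁.smul a), laplacian_const_smul_apply hv₀, laplacian_const_smul_apply hv₁]
    -- (5) FunctionSpaces.Torus.divergence of the glued stress
    have hTsq : IsSmooth (tracelessSq (glueDiff v₀ v₁ t)) := hdt.tracelessSq
    have hrt : IsSmooth (fun z => a' • glueDiff v₀ v₁ t z) := hrd.isSmooth_slice ht
    have hmean : ∫ z, a' • glueDiff v₀ v₁ t z = 0 := by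
      rw [integral_smul, show (fun z => glueDiff v₀ v₁ t z) = fun z => v₁ t z - v₀ t z from rfl,
        integral_sub hv₁.integrable hv₀.integrable, hm₁ t ht, hm₀ t ht, sub_zero, smul_zero]
    have hddiv : IsDivFree (glueDiff v₀ v₁ t) := by
      have e1 : glueDiff v₀ v₁ t = fun z => v₁ t z + ((-1 : ℝ) • v₀ t) z := by funext z; simp [glueDiff, sub_eq_add_neg]
      rw [e1]
      refine IsDivFree.add c1v₁ ((hv₀.smul (-1)).isContDiff (by simp)) (h₁.divFree t ht) (fun z => ?_)
      rw [divergence_const_smul c1v₀, h₀.divFree t ht z, mul_zero]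
    have eD : tensorDivergence (glueStress T θ v₀ v₁ R₀ R₁ t) y =
        (1 - a) • tensorDivergence (R₀ t) y + a • tensorDivergence (R₁ t) y -
          (a * (1 - a)) • (FunctionSpaces.Torus.convect (glueDiff v₀ v₁ t) (glueDiff v₀ v₁ t) y -
            FunctionSpaces.Torus.gradient (fun z => ‖glueDiff v₀ v₁ t z‖ ^ 2 / Fintype.card d) y) +
          a' • glueDiff v₀ v₁ t y := by
      have e1 : glueStress T θ v₀ v₁ R₀ R₁ t = fun z j => ((1 - a) • R₀ t z j + a • R₁ t z j) +
          ((-(a * (1 - a))) • tracelessSq (glueDiff v₀ v₁ t) z j + antidivergence (fun z => a' • glueDiff v₀ v₁ t z) z j) := by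
        funext z j; simp only [glueStress, ha, ha', neg_smul]; abel
      have hA : IsSmooth (fun z j => (1 - a) • R₀ t z j) := hR₀.smul (1 - a)
      have hB : IsSmooth (fun z j => a • R₁ t z j) := hR₁.smul a
      have hC : IsSmooth (fun z j => (-(a * (1 - a))) • tracelessSq (glueDiff v₀ v₁ t) z j) := hTsq.smul _
      have hD : IsSmooth (antidivergence (fun z => a' • glueDiff v₀ v₁ t z)) := isSmooth_antidivergence hrt
      have cA : IsContDiff 1 (fun z j => (1 - a) • R₀ t z j) := hA.isContDiff (by simp)
      have cB : IsContDiff 1 (fun z j => a • R₁ t z j) := hB.isContDiff (by simp)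
      have cC : IsContDiff 1 (fun z j => (-(a * (1 - a))) • tracelessSq (glueDiff v₀ v₁ t) z j) := hC.isContDiff (by simp)
      have cD : IsContDiff 1 (antidivergence (fun z => a' • glueDiff v₀ v₁ t z)) := hD.isContDiff (by simp)
      have cAB : IsContDiff 1 (fun z j => (1 - a) • R₀ t z j + a • R₁ t z j) := (hA.add hB).isContDiff (by simp)
      have cCD : IsContDiff 1 (fun z j => (-(a * (1 - a))) • tracelessSq (glueDiff v₀ v₁ t) z j +
          antidivergence (fun z => a' • glueDiff v₀ v₁ t z) z j) := (hC.add hD).isContDiff (by simp)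
      rw [e1, tensorDivergence_add_apply cAB cCD, tensorDivergence_add_apply cA cB, tensorDivergence_add_apply cC cD,
        tensorDivergence_const_smul_apply (hR₀.isContDiff (by simp)), tensorDivergence_const_smul_apply (hR₁.isContDiff (by simp)),
        tensorDivergence_const_smul_apply (hTsq.isContDiff (by simp)), tensorDivergence_tracelessSq hdt hddiv,
        tensorDivergence_antidivergence hd hrt, hmean, sub_zero]
      simp only [neg_smul]
      abel
    -- assemble
    have m₀ := h₀.momentum t ht y
    have m₁ := h₁.momentum t ht y
    rw [eDt, eC, eG, eL, eD, eCd]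
    set D₀ := FunctionSpaces.Torus.timeDerivWithin (Icc 0 T) v₀ t y
    set D₁ := FunctionSpaces.Torus.timeDerivWithin (Icc 0 T) v₁ t y
    set C₀₀ := FunctionSpaces.Torus.convect (v₀ t) (v₀ t) y
    set C₀₁ := FunctionSpaces.Torus.convect (v₀ t) (v₁ t) y
    set C₁₀ := FunctionSpaces.Torus.convect (v₁ t) (v₀ t) y
    set C₁₁ := FunctionSpaces.Torus.convect (v₁ t) (v₁ t) y
    set G₀ := FunctionSpaces.Torus.gradient (p₀ t) y
    set G₁ := FunctionSpaces.Torus.gradient (p₁ t) y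
    set Gd := FunctionSpaces.Torus.gradient (fun z => ‖glueDiff v₀ v₁ t z‖ ^ 2 / Fintype.card d) y
    set L₀ := FunctionSpaces.Torus.laplacian (v₀ t) y
    set L₁ := FunctionSpaces.Torus.laplacian (v₁ t) y
    set DR₀ := tensorDivergence (R₀ t) y
    set DR₁ := tensorDivergence (R₁ t) y
    set dd := glueDiff v₀ v₁ t y
    -- `m₀ : D₀ + C₀₀ + G₀ = ν • L₀ + DR₀`, `m₁ : D₁ + C₁₁ + G₁ = ν • L₁ + DR₁`
    have key : (1 - a) • D₀ + a • D₁ + a' • dd +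
        ((1 - a) • ((1 - a) • C₀₀ + a • C₀₁) + a • ((1 - a) • C₁₀ + a • C₁₁)) +
        ((1 - a) • G₀ + a • G₁ + (a * (1 - a)) • Gd) -
        (ν • ((1 - a) • L₀ + a • L₁) +
          ((1 - a) • DR₀ + a • DR₁ - (a * (1 - a)) • (C₁₁ - C₁₀ - (C₀₁ - C₀₀) - Gd) + a' • dd)) =
        (1 - a) • (D₀ + C₀₀ + G₀ - (ν • L₀ + DR₀)) + a • (D₁ + C₁₁ + G₁ - (ν • L₁ + DR₁)) := by
      module
    rw [m₀, m₁, sub_self, sub_self, smul_zero, smul_zero, add_zero, sub_eq_zero] at key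
    exact key
  · -- FunctionSpaces.Torus.divergence free
    intro t ht
    have hv₀ : IsSmooth (v₀ t) := h₀.smooth_velocity.isSmooth_slice ht
    have hv₁ : IsSmooth (v₁ t) := h₁.smooth_velocity.isSmooth_slice ht
    have e1 : glueVel θ v₀ v₁ t = fun z => ((1 - θ t) • v₀ t) z + (θ t • v₁ t) z := by funext z; simp [glueVel]
    rw [e1]
    refine IsDivFree.add ((hv₀.smul _).isContDiff (by simp)) ((hv₁.smul _).isContDiff (by simp)) (fun z => ?_) (fun z => ?_)
    · rw [divergence_const_smul (hv₀.isContDiff (by simp)), h₀.divFree t ht z, mul_zero]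
    · rw [divergence_const_smul (hv₁.isContDiff (by simp)), h₁.divFree t ht z, mul_zero]
  · -- symmetry
    intro t ht y i j
    have hrt : IsSmooth (fun z => glueRate T θ t • glueDiff v₀ v₁ t z) := hrd.isSmooth_slice ht
    simp only [glueStress, PiLp.add_apply, PiLp.sub_apply, PiLp.smul_apply, smul_eq_mul]
    rw [h₀.symm t ht y i j, h₁.symm t ht y i j, tracelessSq_symm (glueDiff v₀ v₁ t) y i j, antidivergence_symm hrt y i j]
  · -- trace free
    intro t ht y
    have hrt : IsSmooth (fun z => glueRate T θ t • glueDiff v₀ v₁ t z) := hrd.isSmooth_slice ht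
    simp only [glueStress, PiLp.add_apply, PiLp.sub_apply, PiLp.smul_apply, smul_eq_mul, Finset.sum_add_distrib, Finset.sum_sub_distrib,
      ← Finset.mul_sum, h₀.traceFree t ht y, h₁.traceFree t ht y, tracelessSq_traceFree (by omega) (glueDiff v₀ v₁ t) y,
      antidivergence_trace hd hrt]
    simp
  · -- zero mean of the pressure
    intro t ht
    have hdt : IsSmooth (glueDiff v₀ v₁ t) := hdst.isSmooth_slice ht
    have hp₀ : IsSmooth (p₀ t) := h₀.smooth_pressure.isSmooth_slice ht
    have hp₁ : IsSmooth (p₁ t) := h₁.smooth_pressure.isSmooth_slice ht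
    have hsq : IsSmooth (fun z => ‖glueDiff v₀ v₁ t z‖ ^ 2 / Fintype.card d) := ContDiff.div_const hdt.norm_sq _
    have z1 : HasZeroMean (fun z => ‖glueDiff v₀ v₁ t z‖ ^ 2 / Fintype.card d - ∫ z, ‖glueDiff v₀ v₁ t z‖ ^ 2 / Fintype.card d) :=
      hasZeroMean_sub_integral hsq.integrable
    unfold HasZeroMean at z1 ⊢
    have i0 := hp₀.integrable
    have i1 := hp₁.integrable
    have isq : Integrable (fun z => ‖glueDiff v₀ v₁ t z‖ ^ 2 / Fintype.card d - ∫ z, ‖glueDiff v₀ v₁ t z‖ ^ 2 / Fintype.card d) volume :=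
      (hsq.sub (isSmooth_const (∫ z, ‖glueDiff v₀ v₁ t z‖ ^ 2 / Fintype.card d))).integrable
    show ∫ z, ((1 - θ t) * p₀ t z + θ t * p₁ t z +
      θ t * (1 - θ t) * (‖glueDiff v₀ v₁ t z‖ ^ 2 / Fintype.card d - ∫ z, ‖glueDiff v₀ v₁ t z‖ ^ 2 / Fintype.card d)) = 0
    have iA : Integrable (fun z => (1 - θ t) * p₀ t z) volume := i0.const_mul _
    have iB : Integrable (fun z => θ t * p₁ t z) volume := i1.const_mul _
    have iC : Integrable (fun z => θ t * (1 - θ t) *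
        (‖glueDiff v₀ v₁ t z‖ ^ 2 / Fintype.card d - ∫ z, ‖glueDiff v₀ v₁ t z‖ ^ 2 / Fintype.card d)) volume := isq.const_mul _
    have iAB : Integrable (fun z => (1 - θ t) * p₀ t z + θ t * p₁ t z) volume := iA.add iB
    rw [integral_add iAB iC, integral_add iA iB, integral_const_mul, integral_const_mul, integral_const_mul]
    have e0 : ∫ z, p₀ t z = 0 := h₀.hasZeroMean_pressure t ht
    have e1 : ∫ z, p₁ t z = 0 := h₁.hasZeroMean_pressure t ht
    have e2 : ∫ z, (‖glueDiff v₀ v₁ t z‖ ^ 2 / Fintype.card d - ∫ z, ‖glueDiff v₀ v₁ t z‖ ^ 2 / Fintype.card d) = 0 := z1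
    rw [e0, e1, e2]
    ring

end Glue

/-! ## Pointwise size of the glued stress and of its first derivatives -/

section Bounds

variable {T : ℝ} {θ : ℝ → ℝ} {v₀ v₁ : ℝ → UnitAddTorus d → EuclideanSpace ℝ d} {p₀ p₁ : ℝ → UnitAddTorus d → ℝ}
  {R₀ R₁ : ℝ → UnitAddTorus d → d → EuclideanSpace ℝ d} {ν : ℝ}

omit [DecidableEq d] in
/-- Entries are bounded by the column-sup norm. [folklore] -/
theorem norm_pi_col_le_of_forall {w : d → EuclideanSpace ℝ d} {c : ℝ} (hc : 0 ≤ c) (h : ∀ j, ‖w j‖ ≤ c) : ‖w‖ ≤ c :=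
  (pi_norm_le_iff_of_nonneg hc).2 h

/-- **Space derivative of `v ⊗̊ v`**: `‖∂ₗ(v ⊗̊ v)(y)‖ ≤ 4 ‖v(y)‖ ‖∂ₗv(y)‖`. [folklore] -/
theorem norm_partialDeriv_tracelessSq_le {v : UnitAddTorus d → EuclideanSpace ℝ d} (hv : IsSmooth v) (l : d) (y : UnitAddTorus d) :
    ‖FunctionSpaces.Torus.partialDeriv l (tracelessSq v) y‖ ≤ 4 * ‖v y‖ * ‖FunctionSpaces.Torus.partialDeriv l v y‖ := by
  have h1 : IsContDiff 1 v := hv.isContDiff (by simp)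
  have hT : IsSmooth (tracelessSq v) := hv.tracelessSq
  refine norm_pi_col_le_of_forall (by positivity) fun j => ?_
  rw [partialDeriv_tensor_apply hT l y j]
  have hvj : IsContDiff 1 (fun z => v z j) := (EuclideanSpace.proj j : EuclideanSpace ℝ d →L[ℝ] ℝ).contDiff.comp h1
  have hsq' : IsSmooth (fun z => ‖v z‖ ^ 2 / Fintype.card d) := ContDiff.div_const hv.norm_sq _
  have hsq : IsContDiff 1 (fun z => ‖v z‖ ^ 2 / Fintype.card d) := hsq'.isContDiff (by simp)
  have cA : IsContDiff 1 (fun z => v z j • v z) := ContDiff.smul hvj h1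
  have cB : IsContDiff 1 (fun z => (‖v z‖ ^ 2 / Fintype.card d) • EuclideanSpace.single j (1 : ℝ)) := ContDiff.smul hsq contDiff_const
  have e : (fun z => tracelessSq v z j) = fun z => (fun z => v z j • v z) z - (fun z => (‖v z‖ ^ 2 / Fintype.card d) • EuclideanSpace.single j (1 : ℝ)) z := by
    funext z; rfl
  rw [e, partialDeriv_sub_at cA cB, partialDeriv_smul hvj h1, partialDeriv_smul hsq (isContDiff_const _),
    partialDeriv_const_apply, smul_zero, zero_add, partialDeriv_apply_coord h1 l y j]
  have hsqf : (fun z => ‖v z‖ ^ 2 / Fintype.card d) = fun z => ⟪v z, v z⟫_ℝ * (1 / Fintype.card d) := by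
    funext z; rw [real_inner_self_eq_norm_sq]; ring
  have ed : FunctionSpaces.Torus.partialDeriv l (fun z => ‖v z‖ ^ 2 / Fintype.card d) y =
      (⟪v y, FunctionSpaces.Torus.partialDeriv l v y⟫_ℝ + ⟪FunctionSpaces.Torus.partialDeriv l v y, v y⟫_ℝ) * (1 / Fintype.card d) := by
    have hin : IsContDiff 1 (fun z => ⟪v z, v z⟫_ℝ) := ContDiff.inner ℝ h1 h1
    rw [hsqf, partialDeriv_mul hin (isContDiff_const _), partialDeriv_const_apply, mul_zero, zero_add, partialDeriv_inner h1 h1]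
  rw [ed]
  have hcard : (1 : ℝ) ≤ Fintype.card d := by
    have : Nonempty d := ⟨j⟩
    exact_mod_cast Fintype.card_pos
  have hcd : 0 ≤ 1 / (Fintype.card d : ℝ) := by positivity
  have hcd1 : 1 / (Fintype.card d : ℝ) ≤ 1 := (div_le_one (by linarith)).2 hcard
  set P := FunctionSpaces.Torus.partialDeriv l v y
  have hi : |⟪v y, P⟫_ℝ + ⟪P, v y⟫_ℝ| ≤ 2 * (‖v y‖ * ‖P‖) := by
    have a1 := abs_real_inner_le_norm (v y) P
    have a2 := abs_real_inner_le_norm P (v y)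
    calc |⟪v y, P⟫_ℝ + ⟪P, v y⟫_ℝ| ≤ |⟪v y, P⟫_ℝ| + |⟪P, v y⟫_ℝ| := abs_add_le _ _
      _ ≤ ‖v y‖ * ‖P‖ + ‖P‖ * ‖v y‖ := add_le_add a1 a2
      _ = 2 * (‖v y‖ * ‖P‖) := by ring
  calc ‖v y j • P + P j • v y - ((⟪v y, P⟫_ℝ + ⟪P, v y⟫_ℝ) * (1 / Fintype.card d)) • EuclideanSpace.single j (1 : ℝ)‖
      ≤ ‖v y j • P + P j • v y‖ + ‖((⟪v y, P⟫_ℝ + ⟪P, v y⟫_ℝ) * (1 / Fintype.card d)) • EuclideanSpace.single j (1 : ℝ)‖ := norm_sub_le _ _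
    _ ≤ (‖v y j • P‖ + ‖P j • v y‖) + |⟪v y, P⟫_ℝ + ⟪P, v y⟫_ℝ| * (1 / Fintype.card d) := by
        refine add_le_add (norm_add_le _ _) ?_
        rw [norm_smul, show ‖EuclideanSpace.single j (1 : ℝ)‖ = 1 by simp, mul_one, Real.norm_eq_abs, abs_mul, abs_of_nonneg hcd]
    _ ≤ (‖v y‖ * ‖P‖ + ‖P‖ * ‖v y‖) + 2 * (‖v y‖ * ‖P‖) * 1 := by
        refine add_le_add (add_le_add ?_ ?_) ?_
        · rw [norm_smul]; exact mul_le_mul_of_nonneg_right (PiLp.norm_apply_le (v y) j) (norm_nonneg _)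
        · rw [norm_smul]; exact mul_le_mul_of_nonneg_right (PiLp.norm_apply_le P j) (norm_nonneg _)
        · exact mul_le_mul hi hcd1 hcd (by positivity)
    _ = 4 * ‖v y‖ * ‖P‖ := by ring

/-- **Time derivative of `d ⊗̊ d`**: along a jointly smooth `u`,
`‖∂ₜ(u ⊗̊ u)(t, y)‖ ≤ 4 ‖u(t,y)‖ ‖∂ₜu(t,y)‖`. [folklore] -/
theorem norm_timeDerivWithin_tracelessSq_le {S : Set ℝ} {u : ℝ → UnitAddTorus d → EuclideanSpace ℝ d}
    (hu : FunctionSpaces.Torus.IsSmoothSpaceTimeOn S u) (hS : UniqueDiffOn ℝ S) {t : ℝ} (ht : t ∈ S) (y : UnitAddTorus d) :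
    ‖FunctionSpaces.Torus.timeDerivWithin S (fun s => tracelessSq (u s)) t y‖ ≤
      4 * ‖u t y‖ * ‖FunctionSpaces.Torus.timeDerivWithin S u t y‖ := by
  set P := FunctionSpaces.Torus.timeDerivWithin S u t y with hP
  have k := hu.hasDerivWithinAt_slice ht y
  rw [← hP] at k
  have kj : ∀ j, HasDerivWithinAt (fun s => u s y j) (P j) S t := fun j =>
    ((EuclideanSpace.proj j : EuclideanSpace ℝ d →L[ℝ] ℝ).hasFDerivAt.comp_hasDerivWithinAt t k)
  have ksq : HasDerivWithinAt (fun s => ‖u s y‖ ^ 2 / Fintype.card d) (2 * ⟪u t y, P⟫_ℝ / Fintype.card d) S t := by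
    have := k.norm_sq.div_const (Fintype.card d : ℝ)
    exact this
  have key : HasDerivWithinAt (fun s => tracelessSq (u s) y)
      (fun j => (u t y j • P + P j • u t y) - (2 * ⟪u t y, P⟫_ℝ / Fintype.card d) • EuclideanSpace.single j (1 : ℝ)) S t := by
    refine hasDerivWithinAt_pi.2 fun j => ?_
    have h1 := ((kj j).smul k).sub (ksq.smul_const (EuclideanSpace.single j (1 : ℝ)))
    exact h1
  have e := key.derivWithin (hS t ht)
  unfold FunctionSpaces.Torus.timeDerivWithin at e ⊢
  rw [show (fun τ => tracelessSq (u τ) y) = fun s => tracelessSq (u s) y from rfl, e]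
  refine norm_pi_col_le_of_forall (by positivity) fun j => ?_
  have hcard : (1 : ℝ) ≤ Fintype.card d := by
    have : Nonempty d := ⟨j⟩
    exact_mod_cast Fintype.card_pos
  have hi : |2 * ⟪u t y, P⟫_ℝ / Fintype.card d| ≤ 2 * (‖u t y‖ * ‖P‖) := by
    rw [abs_div, abs_mul, abs_two, Nat.abs_cast]
    calc 2 * |⟪u t y, P⟫_ℝ| / Fintype.card d ≤ 2 * |⟪u t y, P⟫_ℝ| := div_le_self (by positivity) hcard
      _ ≤ 2 * (‖u t y‖ * ‖P‖) := by have := abs_real_inner_le_norm (u t y) P; linarith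
  calc ‖(u t y j • P + P j • u t y) - (2 * ⟪u t y, P⟫_ℝ / Fintype.card d) • EuclideanSpace.single j (1 : ℝ)‖
      ≤ ‖u t y j • P + P j • u t y‖ + ‖(2 * ⟪u t y, P⟫_ℝ / Fintype.card d) • EuclideanSpace.single j (1 : ℝ)‖ := norm_sub_le _ _
    _ ≤ (‖u t y j • P‖ + ‖P j • u t y‖) + |2 * ⟪u t y, P⟫_ℝ / Fintype.card d| := by
        refine add_le_add (norm_add_le _ _) ?_
        rw [norm_smul, show ‖EuclideanSpace.single j (1 : ℝ)‖ = 1 by simp, mul_one, Real.norm_eq_abs]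
    _ ≤ (‖u t y‖ * ‖P‖ + ‖P‖ * ‖u t y‖) + 2 * (‖u t y‖ * ‖P‖) := by
        refine add_le_add (add_le_add ?_ ?_) hi
        · rw [norm_smul]; exact mul_le_mul_of_nonneg_right (PiLp.norm_apply_le (u t y) j) (norm_nonneg _)
        · rw [norm_smul]; exact mul_le_mul_of_nonneg_right (PiLp.norm_apply_le P j) (norm_nonneg _)
    _ = 4 * ‖u t y‖ * ‖P‖ := by ring

variable (h₀ : IsNSReynoldsOn (Icc 0 T) ν v₀ p₀ R₀) (h₁ : IsNSReynoldsOn (Icc 0 T) ν v₁ p₁ R₁) (hT : 0 < T)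
  (hθ : ContDiffOn ℝ ∞ θ (Icc 0 T))
include h₀ h₁ hT hθ

omit hT hθ in
/-- **Size of the glued stress**: for `0 ≤ θ(t) ≤ 1`,
`‖R_θ(t,y)‖ ≤ ‖R₀(t,y)‖ + ‖R₁(t,y)‖ + D₀²/2 + K |θ'(t)| D₀` (`‖d(t,·)‖ ≤ D₀`, `K` the sup
constant of `ℛ`). [folklore] -/
theorem norm_glueStress_le {K : ℝ}
    (hK : ∀ (w : UnitAddTorus d → EuclideanSpace ℝ d), IsSmooth w → ∀ C : ℝ, 0 ≤ C → (∀ x, ‖w x‖ ≤ C) → ∀ x, ‖antidivergence w x‖ ≤ K * C)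
    {t : ℝ} (ht : t ∈ Icc 0 T) (hθ0 : 0 ≤ θ t) (hθ1 : θ t ≤ 1) {D₀ : ℝ} (hD0 : 0 ≤ D₀)
    (hD : ∀ z, ‖glueDiff v₀ v₁ t z‖ ≤ D₀) (y : UnitAddTorus d) :
    ‖glueStress T θ v₀ v₁ R₀ R₁ t y‖ ≤ ‖R₀ t y‖ + ‖R₁ t y‖ + D₀ ^ 2 / 2 + K * (|glueRate T θ t| * D₀) := by
  have hdt : IsSmooth (glueDiff v₀ v₁ t) := (smooth_glueDiff h₀ h₁).isSmooth_slice ht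
  have han : ‖antidivergence (fun z => glueRate T θ t • glueDiff v₀ v₁ t z) y‖ ≤ K * (|glueRate T θ t| * D₀) :=
    hK _ ((isSmooth_const _).smul' hdt) _ (by positivity) (fun z => by rw [norm_smul, Real.norm_eq_abs]; gcongr; exact hD z) y
  have hsq : ‖tracelessSq (glueDiff v₀ v₁ t) y‖ ≤ 2 * D₀ ^ 2 :=
    (norm_tracelessSq_le _ y).trans (by have := hD y; have h0 := norm_nonneg (glueDiff v₀ v₁ t y); nlinarith)
  have hprod : θ t * (1 - θ t) ≤ 1 / 4 := by nlinarith [sq_nonneg (θ t - 1 / 2)]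
  have hprod0 : 0 ≤ θ t * (1 - θ t) := mul_nonneg hθ0 (by linarith)
  have e : glueStress T θ v₀ v₁ R₀ R₁ t y = ((1 - θ t) • R₀ t y + θ t • R₁ t y - (θ t * (1 - θ t)) • tracelessSq (glueDiff v₀ v₁ t) y) +
      antidivergence (fun z => glueRate T θ t • glueDiff v₀ v₁ t z) y := by
    funext j; simp [glueStress]
  rw [e]
  calc ‖((1 - θ t) • R₀ t y + θ t • R₁ t y - (θ t * (1 - θ t)) • tracelessSq (glueDiff v₀ v₁ t) y) +
        antidivergence (fun z => glueRate T θ t • glueDiff v₀ v₁ t z) y‖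
      ≤ ‖(1 - θ t) • R₀ t y + θ t • R₁ t y - (θ t * (1 - θ t)) • tracelessSq (glueDiff v₀ v₁ t) y‖ + K * (|glueRate T θ t| * D₀) :=
        (norm_add_le _ _).trans (add_le_add le_rfl han)
    _ ≤ (‖(1 - θ t) • R₀ t y‖ + ‖θ t • R₁ t y‖ + ‖(θ t * (1 - θ t)) • tracelessSq (glueDiff v₀ v₁ t) y‖) + K * (|glueRate T θ t| * D₀) := by
        gcongr; exact (norm_sub_le _ _).trans (add_le_add (norm_add_le _ _) le_rfl)
    _ ≤ (‖R₀ t y‖ + ‖R₁ t y‖ + (1 / 4) * (2 * D₀ ^ 2)) + K * (|glueRate T θ t| * D₀) := by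
        gcongr
        · rw [norm_smul, Real.norm_eq_abs, abs_of_nonneg (by linarith)]
          exact mul_le_of_le_one_left (norm_nonneg _) (by linarith)
        · rw [norm_smul, Real.norm_eq_abs, abs_of_nonneg hθ0]
          exact mul_le_of_le_one_left (norm_nonneg _) hθ1
        · rw [norm_smul, Real.norm_eq_abs, abs_of_nonneg hprod0]
          exact mul_le_mul hprod hsq (norm_nonneg _) (by norm_num)
    _ = ‖R₀ t y‖ + ‖R₁ t y‖ + D₀ ^ 2 / 2 + K * (|glueRate T θ t| * D₀) := by ring

omit hT hθ in
/-- **Space derivatives of the glued stress**: for `0 ≤ θ(t) ≤ 1`,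
`‖∂ₗR_θ(t,y)‖ ≤ ‖∂ₗR₀(t,y)‖ + ‖∂ₗR₁(t,y)‖ + D₀D₁ + K|θ'(t)|D₁`
(`‖d(t,·)‖ ≤ D₀`, `‖∂ₗd(t,·)‖ ≤ D₁`). [folklore] -/
theorem norm_partialDeriv_glueStress_le {K : ℝ}
    (hK : ∀ (w : UnitAddTorus d → EuclideanSpace ℝ d), IsSmooth w → ∀ C : ℝ, 0 ≤ C → (∀ x, ‖w x‖ ≤ C) → ∀ x, ‖antidivergence w x‖ ≤ K * C)
    {t : ℝ} (ht : t ∈ Icc 0 T) (hθ0 : 0 ≤ θ t) (hθ1 : θ t ≤ 1) (l : d) {D₀ D₁ : ℝ} (hD0 : 0 ≤ D₀) (hD1 : 0 ≤ D₁)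
    (hD : ∀ z, ‖glueDiff v₀ v₁ t z‖ ≤ D₀) (hDl : ∀ z, ‖FunctionSpaces.Torus.partialDeriv l (glueDiff v₀ v₁ t) z‖ ≤ D₁) (y : UnitAddTorus d) :
    ‖FunctionSpaces.Torus.partialDeriv l (glueStress T θ v₀ v₁ R₀ R₁ t) y‖ ≤
      ‖FunctionSpaces.Torus.partialDeriv l (R₀ t) y‖ + ‖FunctionSpaces.Torus.partialDeriv l (R₁ t) y‖ + D₀ * D₁ + K * (|glueRate T θ t| * D₁) := by
  have hdt : IsSmooth (glueDiff v₀ v₁ t) := (smooth_glueDiff h₀ h₁).isSmooth_slice ht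
  have hR₀ : IsSmooth (R₀ t) := h₀.smooth_stress.isSmooth_slice ht
  have hR₁ : IsSmooth (R₁ t) := h₁.smooth_stress.isSmooth_slice ht
  have hTsq : IsSmooth (tracelessSq (glueDiff v₀ v₁ t)) := hdt.tracelessSq
  set a := θ t with ha
  set a' := glueRate T θ t with ha'
  have hrt : IsSmooth (fun z => a' • glueDiff v₀ v₁ t z) := (isSmooth_const _).smul' hdt
  have hAn : IsSmooth (antidivergence (fun z => a' • glueDiff v₀ v₁ t z)) := isSmooth_antidivergence hrt
  have sA : IsSmooth (fun z => (1 - a) • R₀ t z) := hR₀.smul (1 - a)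
  have sB : IsSmooth (fun z => a • R₁ t z) := hR₁.smul a
  have sC : IsSmooth (fun z => (a * (1 - a)) • tracelessSq (glueDiff v₀ v₁ t) z) := hTsq.smul _
  have sAB : IsSmooth (fun z => (1 - a) • R₀ t z + a • R₁ t z) := sA.add sB
  have sABC : IsSmooth (fun z => ((1 - a) • R₀ t z + a • R₁ t z) - (a * (1 - a)) • tracelessSq (glueDiff v₀ v₁ t) z) := sAB.sub sC
  have c1 : ∀ {f : UnitAddTorus d → d → EuclideanSpace ℝ d}, IsSmooth f → IsContDiff 1 f := fun hf => hf.isContDiff (by simp)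
  have e : glueStress T θ v₀ v₁ R₀ R₁ t = fun z => (((1 - a) • R₀ t z + a • R₁ t z) - (a * (1 - a)) • tracelessSq (glueDiff v₀ v₁ t) z) +
      antidivergence (fun z => a' • glueDiff v₀ v₁ t z) z := by
    funext z j; simp [glueStress, ha, ha']
  rw [e, partialDeriv_add_apply (c1 sABC) (c1 hAn), partialDeriv_sub_at (c1 sAB) (c1 sC), partialDeriv_add_apply (c1 sA) (c1 sB),
    partialDeriv_const_smul_at (c1 hR₀), partialDeriv_const_smul_at (c1 hR₁), partialDeriv_const_smul_at (c1 hTsq),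
    partialDeriv_antidivergence_tensor hrt l y]
  -- the four pieces
  have hprod : a * (1 - a) ≤ 1 / 4 := by nlinarith [sq_nonneg (a - 1 / 2)]
  have hprod0 : 0 ≤ a * (1 - a) := mul_nonneg hθ0 (by linarith)
  have p3 : ‖(a * (1 - a)) • FunctionSpaces.Torus.partialDeriv l (tracelessSq (glueDiff v₀ v₁ t)) y‖ ≤ D₀ * D₁ := by
    rw [norm_smul, Real.norm_eq_abs, abs_of_nonneg hprod0]
    have h4 := norm_partialDeriv_tracelessSq_le hdt l y
    have h5 : 4 * ‖glueDiff v₀ v₁ t y‖ * ‖FunctionSpaces.Torus.partialDeriv l (glueDiff v₀ v₁ t) y‖ ≤ 4 * D₀ * D₁ := by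
      have := hD y; have := hDl y
      gcongr
    calc a * (1 - a) * ‖FunctionSpaces.Torus.partialDeriv l (tracelessSq (glueDiff v₀ v₁ t)) y‖ ≤ (1 / 4) * (4 * D₀ * D₁) :=
          mul_le_mul hprod (h4.trans h5) (norm_nonneg _) (by norm_num)
      _ = D₀ * D₁ := by ring
  have p4 : ‖antidivergence (FunctionSpaces.Torus.partialDeriv l fun z => a' • glueDiff v₀ v₁ t z) y‖ ≤ K * (|a'| * D₁) := by
    have ed : FunctionSpaces.Torus.partialDeriv l (fun z => a' • glueDiff v₀ v₁ t z) = fun z => a' • FunctionSpaces.Torus.partialDeriv l (glueDiff v₀ v₁ t) z := by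
      funext z; exact partialDeriv_const_smul_at (hdt.isContDiff (by simp)) a' l z
    rw [ed]
    exact hK _ ((isSmooth_const _).smul' (hdt.partialDeriv l)) _ (by positivity)
      (fun z => by rw [norm_smul, Real.norm_eq_abs]; exact mul_le_mul_of_nonneg_left (hDl z) (abs_nonneg _)) y
  calc ‖(1 - a) • FunctionSpaces.Torus.partialDeriv l (R₀ t) y + a • FunctionSpaces.Torus.partialDeriv l (R₁ t) y -
        (a * (1 - a)) • FunctionSpaces.Torus.partialDeriv l (tracelessSq (glueDiff v₀ v₁ t)) y +
        antidivergence (FunctionSpaces.Torus.partialDeriv l fun z => a' • glueDiff v₀ v₁ t z) y‖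
      ≤ (‖(1 - a) • FunctionSpaces.Torus.partialDeriv l (R₀ t) y‖ + ‖a • FunctionSpaces.Torus.partialDeriv l (R₁ t) y‖ +
          ‖(a * (1 - a)) • FunctionSpaces.Torus.partialDeriv l (tracelessSq (glueDiff v₀ v₁ t)) y‖) +
          ‖antidivergence (FunctionSpaces.Torus.partialDeriv l fun z => a' • glueDiff v₀ v₁ t z) y‖ :=
        (norm_add_le _ _).trans (add_le_add ((norm_sub_le _ _).trans (add_le_add (norm_add_le _ _) le_rfl)) le_rfl)
    _ ≤ (‖FunctionSpaces.Torus.partialDeriv l (R₀ t) y‖ + ‖FunctionSpaces.Torus.partialDeriv l (R₁ t) y‖ + D₀ * D₁) + K * (|a'| * D₁) := by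
        gcongr
        · rw [norm_smul, Real.norm_eq_abs, abs_of_nonneg (by linarith)]
          exact mul_le_of_le_one_left (norm_nonneg _) (by linarith)
        · rw [norm_smul, Real.norm_eq_abs, abs_of_nonneg hθ0]
          exact mul_le_of_le_one_left (norm_nonneg _) hθ1

/-- **Time derivative of the glued stress**: for `0 ≤ θ(t) ≤ 1`, with `θ' = glueRate`,
`θ'' = (glueRate)'` within `[0,T]`, `‖d(t,·)‖ ≤ D₀`, `‖∂ₜd(t,·)‖ ≤ Dₜ`:
`‖∂ₜR_θ(t,y)‖ ≤ |θ'|(‖R₀‖ + ‖R₁‖) + ‖∂ₜR₀‖ + ‖∂ₜR₁‖ + 2|θ'|D₀² + D₀Dₜ + K(|θ''|D₀ + |θ'|Dₜ)`. [folklore] -/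
theorem norm_timeDerivWithin_glueStress_le {K : ℝ}
    (hK : ∀ (w : UnitAddTorus d → EuclideanSpace ℝ d), IsSmooth w → ∀ C : ℝ, 0 ≤ C → (∀ x, ‖w x‖ ≤ C) → ∀ x, ‖antidivergence w x‖ ≤ K * C)
    {t : ℝ} (ht : t ∈ Icc 0 T) (hθ0 : 0 ≤ θ t) (hθ1 : θ t ≤ 1) {D₀ Dt : ℝ} (hD0 : 0 ≤ D₀) (hDt0 : 0 ≤ Dt)
    (hD : ∀ z, ‖glueDiff v₀ v₁ t z‖ ≤ D₀) (hDt : ∀ z, ‖FunctionSpaces.Torus.timeDerivWithin (Icc 0 T) (glueDiff v₀ v₁) t z‖ ≤ Dt)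
    (y : UnitAddTorus d) :
    ‖FunctionSpaces.Torus.timeDerivWithin (Icc 0 T) (glueStress T θ v₀ v₁ R₀ R₁) t y‖ ≤
      |glueRate T θ t| * (‖R₀ t y‖ + ‖R₁ t y‖) + ‖FunctionSpaces.Torus.timeDerivWithin (Icc 0 T) R₀ t y‖ +
        ‖FunctionSpaces.Torus.timeDerivWithin (Icc 0 T) R₁ t y‖ + 2 * |glueRate T θ t| * D₀ ^ 2 + D₀ * Dt +
        K * (|derivWithin (glueRate T θ) (Icc 0 T) t| * D₀ + |glueRate T θ t| * Dt) := by
  have hU : UniqueDiffOn ℝ (Icc (0 : ℝ) T) := uniqueDiffOn_Icc hT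
  have hdst := smooth_glueDiff h₀ h₁
  have hrd := smooth_rate_smul_glueDiff h₀ h₁ hT hθ
  have hdt : IsSmooth (glueDiff v₀ v₁ t) := hdst.isSmooth_slice ht
  set a := θ t with ha
  set a' := glueRate T θ t with ha'
  set a'' := derivWithin (glueRate T θ) (Icc 0 T) t with ha''
  -- derivatives of the cut-off
  have hθd : HasDerivWithinAt θ a' (Icc 0 T) t := (hθ.differentiableOn (by simp) t ht).hasDerivWithinAt
  have hθ'd : HasDerivWithinAt (glueRate T θ) a'' (Icc 0 T) t :=
    ((contDiffOn_derivWithin_Icc hT hθ).differentiableOn (by simp) t ht).hasDerivWithinAt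
  have k1θ : HasDerivWithinAt (fun s => 1 - θ s) (0 - a') (Icc 0 T) t := (hasDerivWithinAt_const t (Icc 0 T) (1 : ℝ)).sub hθd
  have kprod : HasDerivWithinAt (fun s => θ s * (1 - θ s)) (a' * (1 - a) + a * (0 - a')) (Icc 0 T) t := hθd.mul k1θ
  -- derivatives of the slices
  have kR₀ := h₀.smooth_stress.hasDerivWithinAt_slice ht y
  have kR₁ := h₁.smooth_stress.hasDerivWithinAt_slice ht y
  have kT := (isSmoothSpaceTimeOn_tracelessSq' hdst).hasDerivWithinAt_slice ht y
  have kA := (hrd.antidivergence (convex_Icc 0 T) (by rw [interior_Icc]; exact nonempty_Ioo.2 hT)).hasDerivWithinAt_slice ht y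
  set DR₀ := FunctionSpaces.Torus.timeDerivWithin (Icc 0 T) R₀ t y
  set DR₁ := FunctionSpaces.Torus.timeDerivWithin (Icc 0 T) R₁ t y
  set DT := FunctionSpaces.Torus.timeDerivWithin (Icc 0 T) (fun s => tracelessSq (glueDiff v₀ v₁ s)) t y
  set DA := FunctionSpaces.Torus.timeDerivWithin (Icc 0 T) (fun s => antidivergence (fun z => glueRate T θ s • glueDiff v₀ v₁ s z)) t y
  have key : HasDerivWithinAt (fun s => glueStress T θ v₀ v₁ R₀ R₁ s y)
      (((1 - θ t) • DR₀ + (0 - a') • R₀ t y) + (θ t • DR₁ + a' • R₁ t y) -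
        ((θ t * (1 - θ t)) • DT + (a' * (1 - a) + a * (0 - a')) • tracelessSq (glueDiff v₀ v₁ t) y) + DA) (Icc 0 T) t := by
    have h := (((k1θ.smul kR₀).add (hθd.smul kR₁)).sub (kprod.smul kT)).add kA
    exact h
  have e := key.derivWithin (hU t ht)
  unfold FunctionSpaces.Torus.timeDerivWithin at e ⊢
  rw [show (fun τ => glueStress T θ v₀ v₁ R₀ R₁ τ y) = fun s => glueStress T θ v₀ v₁ R₀ R₁ s y from rfl, e]
  -- sizes of the pieces
  have hprod : a * (1 - a) ≤ 1 / 4 := by nlinarith [sq_nonneg (a - 1 / 2)]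
  have hprod0 : 0 ≤ a * (1 - a) := mul_nonneg hθ0 (by linarith)
  have hcoef : |a' * (1 - a) + a * (0 - a')| ≤ |a'| := by
    rw [show a' * (1 - a) + a * (0 - a') = a' * (1 - 2 * a) by ring, abs_mul]
    have : |1 - 2 * a| ≤ 1 := by rw [abs_le]; constructor <;> linarith
    exact mul_le_of_le_one_right (abs_nonneg _) this
  have hsq : ‖tracelessSq (glueDiff v₀ v₁ t) y‖ ≤ 2 * D₀ ^ 2 :=
    (norm_tracelessSq_le _ y).trans (by have := hD y; have h0 := norm_nonneg (glueDiff v₀ v₁ t y); nlinarith)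
  have hDT : ‖DT‖ ≤ 4 * D₀ * Dt := by
    refine (norm_timeDerivWithin_tracelessSq_le hdst hU ht y).trans ?_
    have := hD y; have := hDt y
    gcongr
  have hDA : ‖DA‖ ≤ K * (|a''| * D₀ + |a'| * Dt) := by
    refine norm_timeDerivWithin_antidivergence_le hK hT hrd ht (by positivity) (fun z => ?_) y
    have kd := hdst.hasDerivWithinAt_slice ht z
    have kz : HasDerivWithinAt (fun s => glueRate T θ s • glueDiff v₀ v₁ s z)
        (glueRate T θ t • FunctionSpaces.Torus.timeDerivWithin (Icc 0 T) (glueDiff v₀ v₁) t z + a'' • glueDiff v₀ v₁ t z) (Icc 0 T) t :=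
      hθ'd.smul kd
    have ez := kz.derivWithin (hU t ht)
    unfold FunctionSpaces.Torus.timeDerivWithin at ez ⊢
    rw [show (fun τ => glueRate T θ τ • glueDiff v₀ v₁ τ z) = fun s => glueRate T θ s • glueDiff v₀ v₁ s z from rfl, ez]
    calc ‖glueRate T θ t • derivWithin (fun τ => glueDiff v₀ v₁ τ z) (Icc 0 T) t + a'' • glueDiff v₀ v₁ t z‖
        ≤ ‖glueRate T θ t • derivWithin (fun τ => glueDiff v₀ v₁ τ z) (Icc 0 T) t‖ + ‖a'' • glueDiff v₀ v₁ t z‖ := norm_add_le _ _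
      _ ≤ |a'| * Dt + |a''| * D₀ := by
          rw [norm_smul, norm_smul, Real.norm_eq_abs, Real.norm_eq_abs]
          exact add_le_add (mul_le_mul_of_nonneg_left (hDt z) (abs_nonneg _)) (mul_le_mul_of_nonneg_left (hD z) (abs_nonneg _))
      _ = |a''| * D₀ + |a'| * Dt := by ring
  calc ‖((1 - θ t) • DR₀ + (0 - a') • R₀ t y) + (θ t • DR₁ + a' • R₁ t y) -
        ((θ t * (1 - θ t)) • DT + (a' * (1 - a) + a * (0 - a')) • tracelessSq (glueDiff v₀ v₁ t) y) + DA‖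
      ≤ ((‖(1 - θ t) • DR₀‖ + ‖(0 - a') • R₀ t y‖) + (‖θ t • DR₁‖ + ‖a' • R₁ t y‖) +
          (‖(θ t * (1 - θ t)) • DT‖ + ‖(a' * (1 - a) + a * (0 - a')) • tracelessSq (glueDiff v₀ v₁ t) y‖)) + ‖DA‖ := by
        refine (norm_add_le _ _).trans (add_le_add ?_ le_rfl)
        refine (norm_sub_le _ _).trans (add_le_add ((norm_add_le _ _).trans (add_le_add (norm_add_le _ _) (norm_add_le _ _))) (norm_add_le _ _))
    _ ≤ ((‖DR₀‖ + |a'| * ‖R₀ t y‖) + (‖DR₁‖ + |a'| * ‖R₁ t y‖) + ((1 / 4) * (4 * D₀ * Dt) + |a'| * (2 * D₀ ^ 2))) +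
          K * (|a''| * D₀ + |a'| * Dt) := by
        gcongr
        · rw [norm_smul, Real.norm_eq_abs, abs_of_nonneg (by linarith)]
          exact mul_le_of_le_one_left (norm_nonneg _) (by linarith)
        · rw [norm_smul, Real.norm_eq_abs, zero_sub, abs_neg]
        · rw [norm_smul, Real.norm_eq_abs, abs_of_nonneg hθ0]
          exact mul_le_of_le_one_left (norm_nonneg _) hθ1
        · rw [norm_smul, Real.norm_eq_abs]
        · rw [norm_smul, Real.norm_eq_abs, abs_of_nonneg hprod0]
          exact mul_le_mul hprod hDT (norm_nonneg _) (by norm_num)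
        · rw [norm_smul, Real.norm_eq_abs]
          exact mul_le_mul hcoef hsq (norm_nonneg _) (abs_nonneg _)
    _ = |a'| * (‖R₀ t y‖ + ‖R₁ t y‖) + ‖DR₀‖ + ‖DR₁‖ + 2 * |a'| * D₀ ^ 2 + D₀ * Dt + K * (|a''| * D₀ + |a'| * Dt) := by ring

end Bounds

/-! ## Pointwise size of the glued velocity -/

section VelBounds

variable {T : ℝ} {θ : ℝ → ℝ} {v₀ v₁ : ℝ → UnitAddTorus d → EuclideanSpace ℝ d} {p₀ p₁ : ℝ → UnitAddTorus d → ℝ}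
  {R₀ R₁ : ℝ → UnitAddTorus d → d → EuclideanSpace ℝ d} {ν : ℝ}

omit [Fintype d] [DecidableEq d] in
/-- A convex combination of two vectors of norm `≤ B` has norm `≤ B`. [folklore] -/
theorem norm_convex_comb_le {E : Type*} [SeminormedAddCommGroup E] [NormedSpace ℝ E] {a B : ℝ} (ha0 : 0 ≤ a) (ha1 : a ≤ 1)
    {u w : E} (hu : ‖u‖ ≤ B) (hw : ‖w‖ ≤ B) : ‖(1 - a) • u + a • w‖ ≤ B := by
  calc ‖(1 - a) • u + a • w‖ ≤ ‖(1 - a) • u‖ + ‖a • w‖ := norm_add_le _ _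
    _ = (1 - a) * ‖u‖ + a * ‖w‖ := by rw [norm_smul, norm_smul, Real.norm_eq_abs, Real.norm_eq_abs, abs_of_nonneg (by linarith), abs_of_nonneg ha0]
    _ ≤ (1 - a) * B + a * B := add_le_add (mul_le_mul_of_nonneg_left hu (by linarith)) (mul_le_mul_of_nonneg_left hw ha0)
    _ = B := by ring

omit [DecidableEq d] in
/-- **Sup of the glued velocity**: `‖v₀‖, ‖v₁‖ ≤ B ⇒ ‖v_θ‖ ≤ B` for `0 ≤ θ ≤ 1`. [folklore] -/
theorem norm_glueVel_le {t : ℝ} (hθ0 : 0 ≤ θ t) (hθ1 : θ t ≤ 1) {B : ℝ} {y : UnitAddTorus d} (h0 : ‖v₀ t y‖ ≤ B) (h1 : ‖v₁ t y‖ ≤ B) :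
    ‖glueVel θ v₀ v₁ t y‖ ≤ B :=
  norm_convex_comb_le hθ0 hθ1 h0 h1

omit [DecidableEq d] in
/-- `‖v_θ - v₀‖ ≤ ‖d‖` for `0 ≤ θ ≤ 1`. [folklore] -/
theorem norm_glueVel_sub_le {t : ℝ} (hθ0 : 0 ≤ θ t) (hθ1 : θ t ≤ 1) (y : UnitAddTorus d) :
    ‖glueVel θ v₀ v₁ t y - v₀ t y‖ ≤ ‖glueDiff v₀ v₁ t y‖ := by
  rw [glueVel_eq_add, add_sub_cancel_left, norm_smul, Real.norm_eq_abs, abs_of_nonneg hθ0]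
  exact mul_le_of_le_one_left (norm_nonneg _) hθ1

omit [DecidableEq d] in
/-- **The energy density of the glued velocity**: `|‖v_θ‖² - ‖v₀‖²| ≤ 2‖v₀‖‖d‖ + ‖d‖²` for `0 ≤ θ ≤ 1`. [folklore] -/
theorem abs_norm_sq_glueVel_sub_le {t : ℝ} (hθ0 : 0 ≤ θ t) (hθ1 : θ t ≤ 1) (y : UnitAddTorus d) :
    |‖glueVel θ v₀ v₁ t y‖ ^ 2 - ‖v₀ t y‖ ^ 2| ≤ 2 * ‖v₀ t y‖ * ‖glueDiff v₀ v₁ t y‖ + ‖glueDiff v₀ v₁ t y‖ ^ 2 := by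
  rw [glueVel_eq_add]
  set u := v₀ t y
  set w := θ t • glueDiff v₀ v₁ t y with hw
  have hw' : ‖w‖ ≤ ‖glueDiff v₀ v₁ t y‖ := by
    rw [hw, norm_smul, Real.norm_eq_abs, abs_of_nonneg hθ0]; exact mul_le_of_le_one_left (norm_nonneg _) hθ1
  have e : ‖u + w‖ ^ 2 - ‖u‖ ^ 2 = 2 * ⟪u, w⟫_ℝ + ‖w‖ ^ 2 := by
    rw [norm_add_sq_real]; ring
  rw [e]
  have hi := abs_real_inner_le_norm u w
  calc |2 * ⟪u, w⟫_ℝ + ‖w‖ ^ 2| ≤ |2 * ⟪u, w⟫_ℝ| + |‖w‖ ^ 2| := abs_add_le _ _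
    _ = 2 * |⟪u, w⟫_ℝ| + ‖w‖ ^ 2 := by rw [abs_mul, abs_two, abs_of_nonneg (sq_nonneg ‖w‖)]
    _ ≤ 2 * (‖u‖ * ‖w‖) + ‖w‖ ^ 2 := by linarith
    _ ≤ 2 * (‖u‖ * ‖glueDiff v₀ v₁ t y‖) + ‖glueDiff v₀ v₁ t y‖ ^ 2 := by
        have h0 : 0 ≤ ‖w‖ := norm_nonneg _
        gcongr
    _ = 2 * ‖u‖ * ‖glueDiff v₀ v₁ t y‖ + ‖glueDiff v₀ v₁ t y‖ ^ 2 := by ring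

variable (h₀ : IsNSReynoldsOn (Icc 0 T) ν v₀ p₀ R₀) (h₁ : IsNSReynoldsOn (Icc 0 T) ν v₁ p₁ R₁) (hT : 0 < T)
  (hθ : ContDiffOn ℝ ∞ θ (Icc 0 T))
include h₀ h₁ hT hθ

omit hT hθ in
/-- **Space derivatives of the glued velocity**: `∂ᵢv_θ = (1-θ)∂ᵢv₀ + θ∂ᵢv₁`, so
`‖∂ᵢv₀‖, ‖∂ᵢv₁‖ ≤ B ⇒ ‖∂ᵢv_θ‖ ≤ B`. [folklore] -/
theorem norm_partialDeriv_glueVel_le {t : ℝ} (ht : t ∈ Icc 0 T) (hθ0 : 0 ≤ θ t) (hθ1 : θ t ≤ 1) (i : d) {B : ℝ} {y : UnitAddTorus d}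
    (h0 : ‖FunctionSpaces.Torus.partialDeriv i (v₀ t) y‖ ≤ B) (h1 : ‖FunctionSpaces.Torus.partialDeriv i (v₁ t) y‖ ≤ B) :
    ‖FunctionSpaces.Torus.partialDeriv i (glueVel θ v₀ v₁ t) y‖ ≤ B := by
  have hv₀ : IsSmooth (v₀ t) := h₀.smooth_velocity.isSmooth_slice ht
  have hv₁ : IsSmooth (v₁ t) := h₁.smooth_velocity.isSmooth_slice ht
  have sA : IsSmooth (fun z => (1 - θ t) • v₀ t z) := hv₀.smul _
  have sB : IsSmooth (fun z => θ t • v₁ t z) := hv₁.smul _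
  have e : glueVel θ v₀ v₁ t = fun z => (1 - θ t) • v₀ t z + θ t • v₁ t z := by funext z; rfl
  rw [e, partialDeriv_add_apply (sA.isContDiff (by simp)) (sB.isContDiff (by simp)),
    partialDeriv_const_smul_at (hv₀.isContDiff (by simp)), partialDeriv_const_smul_at (hv₁.isContDiff (by simp))]
  exact norm_convex_comb_le hθ0 hθ1 h0 h1

/-- **Time derivative of the glued velocity**: `∂ₜv_θ = (1-θ)∂ₜv₀ + θ∂ₜv₁ + θ'd`, so
`‖∂ₜv_θ‖ ≤ B + |θ'| ‖d‖` when `‖∂ₜv₀‖, ‖∂ₜv₁‖ ≤ B`. [folklore] -/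
theorem norm_timeDerivWithin_glueVel_le {t : ℝ} (ht : t ∈ Icc 0 T) (hθ0 : 0 ≤ θ t) (hθ1 : θ t ≤ 1) {B : ℝ} {y : UnitAddTorus d}
    (h0 : ‖FunctionSpaces.Torus.timeDerivWithin (Icc 0 T) v₀ t y‖ ≤ B) (h1 : ‖FunctionSpaces.Torus.timeDerivWithin (Icc 0 T) v₁ t y‖ ≤ B) :
    ‖FunctionSpaces.Torus.timeDerivWithin (Icc 0 T) (glueVel θ v₀ v₁) t y‖ ≤ B + |glueRate T θ t| * ‖glueDiff v₀ v₁ t y‖ := by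
  have hU : UniqueDiffOn ℝ (Icc (0 : ℝ) T) := uniqueDiffOn_Icc hT
  have hθd : HasDerivWithinAt θ (glueRate T θ t) (Icc 0 T) t := (hθ.differentiableOn (by simp) t ht).hasDerivWithinAt
  have k₀ := h₀.smooth_velocity.hasDerivWithinAt_slice ht y
  have k₁ := h₁.smooth_velocity.hasDerivWithinAt_slice ht y
  have k1θ : HasDerivWithinAt (fun s => 1 - θ s) (0 - glueRate T θ t) (Icc 0 T) t := (hasDerivWithinAt_const t (Icc 0 T) (1 : ℝ)).sub hθd
  have key : HasDerivWithinAt (fun τ => glueVel θ v₀ v₁ τ y)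
      ((1 - θ t) • FunctionSpaces.Torus.timeDerivWithin (Icc 0 T) v₀ t y + (0 - glueRate T θ t) • v₀ t y +
        (θ t • FunctionSpaces.Torus.timeDerivWithin (Icc 0 T) v₁ t y + glueRate T θ t • v₁ t y)) (Icc 0 T) t :=
    (k1θ.smul k₀).add (hθd.smul k₁)
  have e := key.derivWithin (hU t ht)
  unfold FunctionSpaces.Torus.timeDerivWithin at e ⊢
  rw [e]
  have e2 : (1 - θ t) • derivWithin (fun τ => v₀ τ y) (Icc 0 T) t + (0 - glueRate T θ t) • v₀ t y +
      (θ t • derivWithin (fun τ => v₁ τ y) (Icc 0 T) t + glueRate T θ t • v₁ t y) =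
      ((1 - θ t) • derivWithin (fun τ => v₀ τ y) (Icc 0 T) t + θ t • derivWithin (fun τ => v₁ τ y) (Icc 0 T) t) +
        glueRate T θ t • glueDiff v₀ v₁ t y := by
    simp only [glueDiff, smul_sub, zero_sub, neg_smul]; abel
  rw [e2]
  calc _ ≤ ‖(1 - θ t) • derivWithin (fun τ => v₀ τ y) (Icc 0 T) t + θ t • derivWithin (fun τ => v₁ τ y) (Icc 0 T) t‖ +
        ‖glueRate T θ t • glueDiff v₀ v₁ t y‖ := norm_add_le _ _
    _ ≤ B + |glueRate T θ t| * ‖glueDiff v₀ v₁ t y‖ := by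
        refine add_le_add (norm_convex_comb_le hθ0 hθ1 h0 h1) ?_
        rw [norm_smul, Real.norm_eq_abs]

end VelBounds

end Torus

end Literature.Analysis.FluidPDE
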